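import Literature.NumberTheory.LFunctions.RodgersTaoRiemannVonMangoldt
import Literature.NumberTheory.LFunctions.RodgersTaoNotation
import Literature.NumberTheory.LFunctions.RodgersTaoZeroDynamics
import Literature.NumberTheory.LFunctions.RodgersTaoEnergyProofs
import Literature.NumberTheory.LFunctions.RodgersTaoZerosProofs
import Literature.NumberTheory.LFunctions.RodgersTaoZeroSet
import Mathlib.Analysis.SpecialFunctions.Pow.Real
import HarnessLib

/-!
# Rodgers–Tao 2020, §3: Lemma 3.1 (spacing of the classical locations) — PROOFS

LABEL (C3 / rh-crit-rt, LADDER-RH §1 COLUMN 3 DBN, bears_on N-C/N-P): **RH-FREE CONTENT.** This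
module DISCHARGES the four RH-free named facts of `RodgersTaoRiemannVonMangoldt.lean` —
`lemma31_i` (eq. (43)), `lemma31_i_order` (the «in particular» clause of Lemma 3.1 (i)),
`lemma31_iii` (eq. (45), corrected main term `4π(k−j)/log(ξ_j/4π)`) and `lemma31_ii` (eq. (44)) —
by the printed argument (arXiv:1801.05914v4 l.593–616 = FMP pp.21–22: inversion of
`Ψ(ξ) = (ξ/4π)(log(ξ/4π) − 1)` and the mean value theorem for `Ψ` between two classical
locations), REFUTES the as-printed form of (45) (main term `4π(k−j)/log ξ_j`), and proves the
RH-FREE upper half of display (37), `N_0([0,T]) ≤ Ψ(T) + O(log₊ T)` unconditionally (section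
`Eq37Upper`: real zeros of `H_0` ↦ critical zeros of `ζ`, `N(T/2) = Ψ(T) + O(log T)` by the tree
theorem `riemann_von_mangoldt_holds`). Apart from that last section (which uses the tree's `H_0`/`ζ`
dictionary, no hypothesis on `Λ`), pure real analysis about `rodgersTaoPsi` / `classicalLocation`.
Every discharge here is CONTENT (not ex falso). The section «Corollary 3.3 (50) as an RH-FREE
schema» proves the printed deduction (48) ⟹ (50) at any fixed time `t > Λ`
(`cor33_location_of_count_estimate`: a zero-counting estimate `|N_t([0,T]) − Ψ(T)| ≤ A log₊² T`
gives `|x_j(t) − ξ_j| ≤ B log₊ ξ_j` for all `j ≥ 1`, explicit `B`; and `cor33_order_of_location`: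
that location law gives (51) `x_j(t) ≍ j/log₊ ξ_j`), separating the content of Corollary 3.3 from
the (vacuous-as-printed) Theorem 3.2. A later section records the R1c bridges
(`rfl`) identifying the statements file's notation carriers with the tree's names of record
(`logPlus`, `classicalLocationZ`, `deBruijnZeroZ`). WHAT THIS IS NOT: an upper bound on critical-line
zeros is not a statement about RH; nothing here bears on the truth of RH.

## The argument (as printed, with the constants made explicit)

Write `u = ξ/4π ≥ 1` and `ℓ(ξ) = log(ξ/4π)`, so `Ψ(ξ) = u(ℓ − 1)`. For `y ≥ 1`, `ξ_y > 4πe`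
(`Ψ(4πe) = 0 < 1`), hence `ℓ(ξ_y) > 1` and `log ξ_y ≤ 4 ℓ(ξ_y)` (`log 4π < 3`).
* (i): at `ξ = ξ_j`, `ξ_j log₊ j/(4πj) = log₊(Ψ ξ)/(ℓ − 1)`, and for `u ≥ e^{L₀}`,
  `L₀ = (4/ε + 2)²`: `(1−ε)(ℓ−1) ≤ ℓ + log(ℓ−1) ≤ log(2 + u(ℓ−1)) ≤ ℓ + log ℓ ≤ (1+ε)(ℓ−1)`
  (`log ℓ ≤ 2√ℓ`); transfer `j ≥ Ψ(4πe^{L₀}) ⇔ ξ_j ≥ 4πe^{L₀}`.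
* (i), «in particular»: (43) with `ε = ½` beyond `j₁`, and on `[1, j₁]` both `ξ_j ∈ [4π, ξ_{j₁}]`
  and `j/log₊ j ∈ [1/log₊ j₁, j₁/log 2]`; `log₊ j ≤ 3 log₊ ξ_j` from `j = Ψ(ξ_j) ≤ ξ_j log ξ_j ≤ ξ_j²`,
  and `log₊ ξ_j ≤ (1 + log(2+2C)/log 2) log₊ j` from `ξ_j ≤ 2Cj`.
* (iii): mean value theorem `ξ_k − ξ_j = 4π(k−j)/ℓ(θ)`, `θ` between `ξ_j`, `ξ_k`;
  `|1/ℓ(θ) − 1/ℓ(ξ_j)| ≤ |log(θ/ξ_j)|/(ℓ(θ)ℓ(ξ_j))`, `|log(θ/ξ_j)| ≤ |ξ_k − ξ_j|/min(ξ_j, ξ_k)`,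
  `ξℓ(ξ) ≥ 4πΨ(ξ)`, and for `k < j ≤ Kk`, `ℓ(ξ_k) ≥ ℓ(ξ_j)/(1 + log(CK/c))`.
* (ii): lower bound uniformly by the mean value theorem (`ℓ(θ) ≤ log₊(ξ_j + ξ_k)`); upper bound by
  the printed cases `k > 2j` (triangle inequality + (i)), `j ≤ k ≤ 2j` (mean value theorem + (i)),
  opposite signs ((i)).

## References

* [RodgersTaoFMP2020] B. Rodgers, T. Tao, Forum Math. Pi 8 (2020) e6 = arXiv:1801.05914v4, §3,
  Lemma 3.1 = FMP Lemma 8 and its proof, pp.21–22.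
-/

noncomputable section

open Real Set

namespace Literature.NumberTheory.LFunctions.RodgersTao2020

/-! ## Elementary facts about `Ψ` and `ξ` used throughout -/

/-- `Ψ(ξ) = (ξ/4π)(log(ξ/4π) − 1)`. [cite: RodgersTaoFMP2020, §3 eq. (38) p.20] -/
theorem rodgersTaoPsi_eq_mul (ξ : ℝ) :
    rodgersTaoPsi ξ = ξ / (4 * π) * (Real.log (ξ / (4 * π)) - 1) := by
  rw [rodgersTaoPsi_eq]; ring

/-- `Ψ(4πe) = 0`. [cite: RodgersTaoFMP2020, §3 eq. (38) p.20] -/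
theorem rodgersTaoPsi_four_pi_mul_exp_one : rodgersTaoPsi (4 * π * Real.exp 1) = 0 := by
  have h := rodgersTaoPsi_four_pi_mul_exp (-1)
  norm_num at h
  simpa using h

/-- `log 4π < 3` (since `4π < 16 < e³`). [cite: RodgersTaoFMP2020, §3 p.20 (footnote to (38))] -/
theorem log_four_pi_lt_three : Real.log (4 * π) < 3 := by
  have h16 : (4 : ℝ) * π < 16 := by nlinarith [Real.pi_lt_four]
  have hexp : (16 : ℝ) < Real.exp 3 := by
    have hlow : (2.7 : ℝ) < Real.exp 1 := by
      have := Real.exp_one_gt_d9; linarith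
    have h3 : Real.exp 3 = Real.exp 1 ^ 3 := by
      rw [← Real.exp_nat_mul]; norm_num
    have hpow : (2.7 : ℝ) ^ 3 < Real.exp 1 ^ 3 :=
      pow_lt_pow_left₀ hlow (by norm_num) (by norm_num)
    rw [h3]; linarith [show (16 : ℝ) < 2.7 ^ 3 by norm_num]
  calc Real.log (4 * π) < Real.log (Real.exp 3) :=
        Real.log_lt_log (by positivity) (h16.trans hexp)
    _ = 3 := Real.log_exp 3

/-- For `y ≥ 1`: `4πe < ξ_y` (as `Ψ(4πe) = 0 < 1 ≤ y = Ψ(ξ_y)` and `Ψ` is increasing on `[4π, ∞)`).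
[cite: RodgersTaoFMP2020, §3 eq. (42) p.21] -/
theorem four_pi_mul_exp_one_lt_classicalLocation {y : ℝ} (hy : 1 ≤ y) :
    4 * π * Real.exp 1 < classicalLocation y := by
  have hy' : (-1 : ℝ) ≤ y := by linarith
  have h4 : 4 * π ≤ 4 * π * Real.exp 1 := by
    have : (1 : ℝ) ≤ Real.exp 1 := Real.one_le_exp (by norm_num)
    nlinarith [Real.pi_pos]
  by_contra hle
  push Not at hle
  have hmono := strictMonoOn_rodgersTaoPsi.monotoneOn
    (show classicalLocation y ∈ Ici (4 * π) from four_pi_le_classicalLocation hy')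
    (show 4 * π * Real.exp 1 ∈ Ici (4 * π) from h4) hle
  rw [rodgersTaoPsi_classicalLocation hy', rodgersTaoPsi_four_pi_mul_exp_one] at hmono
  linarith

/-- For `y ≥ 1`: `1 < log(ξ_y/4π)`. [cite: RodgersTaoFMP2020, §3 eq. (42) p.21] -/
theorem one_lt_log_classicalLocation_div {y : ℝ} (hy : 1 ≤ y) :
    1 < Real.log (classicalLocation y / (4 * π)) := by
  have hπ : 0 < 4 * π := by positivity
  have h := four_pi_mul_exp_one_lt_classicalLocation hy
  have h' : Real.exp 1 < classicalLocation y / (4 * π) := by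
    rw [lt_div_iff₀ hπ]; linarith
  calc (1 : ℝ) = Real.log (Real.exp 1) := (Real.log_exp 1).symm
    _ < Real.log (classicalLocation y / (4 * π)) := Real.log_lt_log (Real.exp_pos 1) h'

/-- For `y ≥ 1`: `1 < ξ_y` (indeed `ξ_y > 4πe`). [cite: RodgersTaoFMP2020, §3 eq. (42) p.21] -/
theorem one_lt_classicalLocation {y : ℝ} (hy : 1 ≤ y) : 1 < classicalLocation y :=
  lt_of_lt_of_le (by linarith [Real.pi_gt_three]) (four_pi_le_classicalLocation (by linarith))

/-- For `y ≥ 1`: `log ξ_y = log(ξ_y/4π) + log 4π ≤ 4 log(ξ_y/4π)`.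
[cite: RodgersTaoFMP2020, §3 p.21 (proof of Lemma 8)] -/
theorem log_classicalLocation_le {y : ℝ} (hy : 1 ≤ y) :
    Real.log (classicalLocation y) ≤ 4 * Real.log (classicalLocation y / (4 * π)) := by
  have hπ : 0 < 4 * π := by positivity
  have hξ : 0 < classicalLocation y := classicalLocation_pos (by linarith)
  have hsplit : Real.log (classicalLocation y) =
      Real.log (classicalLocation y / (4 * π)) + Real.log (4 * π) := by
    rw [Real.log_div hξ.ne' hπ.ne']; ring
  have h1 := one_lt_log_classicalLocation_div hy
  have h3 := log_four_pi_lt_three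
  rw [hsplit]; linarith

/-- For `y ≥ 1`: `log(ξ_y/4π) ≤ log ξ_y` (`4π ≥ 1`). [cite: RodgersTaoFMP2020, §3 p.21 (proof of Lemma 8)] -/
theorem log_classicalLocation_div_le {y : ℝ} (hy : 1 ≤ y) :
    Real.log (classicalLocation y / (4 * π)) ≤ Real.log (classicalLocation y) := by
  have hξ : 0 < classicalLocation y := classicalLocation_pos (by linarith)
  exact Real.log_le_log (div_pos hξ (by positivity))
    (div_le_self hξ.le one_le_four_pi)

/-- `ξ · log(ξ/4π) ≥ 4π Ψ(ξ)`, i.e. `u ℓ ≥ u(ℓ − 1)` for `ξ ≥ 0`.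
[cite: RodgersTaoFMP2020, §3 eq. (38) p.20] -/
theorem four_pi_mul_rodgersTaoPsi_le {ξ : ℝ} (hξ : 0 ≤ ξ) :
    4 * π * rodgersTaoPsi ξ ≤ ξ * Real.log (ξ / (4 * π)) := by
  have hπ : 0 < 4 * π := by positivity
  rw [rodgersTaoPsi_eq_mul]
  have : 4 * π * (ξ / (4 * π) * (Real.log (ξ / (4 * π)) - 1)) =
      ξ * Real.log (ξ / (4 * π)) - ξ := by field_simp
  rw [this]; linarith

/-- For `y ≥ 1`: `4π y ≤ ξ_y log(ξ_y/4π)`. [cite: RodgersTaoFMP2020, §3 eq. (46) p.21] -/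
theorem four_pi_mul_le_classicalLocation_mul_log {y : ℝ} (hy : 1 ≤ y) :
    4 * π * y ≤ classicalLocation y * Real.log (classicalLocation y / (4 * π)) := by
  have h := four_pi_mul_rodgersTaoPsi_le (classicalLocation_pos (by linarith : (-1:ℝ) ≤ y)).le
  rwa [rodgersTaoPsi_classicalLocation (by linarith : (-1:ℝ) ≤ y)] at h

/-- **Mean value theorem between two classical locations** (the core of the printed proof of
Lemma 3.1 (ii)–(iii), v4 l.602–607): for `−1 ≤ y < y'` there is `θ ∈ (ξ_y, ξ_{y'})` with
`ξ_{y'} − ξ_y = 4π(y' − y)/log(θ/4π)` and `0 < log(θ/4π)`.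
[cite: RodgersTaoFMP2020, Lemma 3.1 (proof) = Lemma 8 p.22] -/
theorem exists_mvt_classicalLocation {y y' : ℝ} (hy : -1 ≤ y) (hlt : y < y') :
    ∃ θ : ℝ, classicalLocation y < θ ∧ θ < classicalLocation y' ∧
      0 < Real.log (θ / (4 * π)) ∧
      classicalLocation y' - classicalLocation y = 4 * π * (y' - y) / Real.log (θ / (4 * π)) := by
  have hy' : -1 ≤ y' := by linarith
  have hξlt : classicalLocation y < classicalLocation y' :=
    strictMonoOn_classicalLocation hy hy' hlt
  have h4 := four_pi_le_classicalLocation hy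
  have hπ : 0 < 4 * π := by positivity
  obtain ⟨θ, hθ, hθ'⟩ := exists_hasDerivAt_eq_slope rodgersTaoPsi
    (fun θ ↦ Real.log (θ / (4 * π)) / (4 * π)) hξlt continuous_rodgersTaoPsi.continuousOn
    (fun θ hθ ↦ hasDerivAt_rodgersTaoPsi (hπ.trans_le (h4.trans hθ.1.le)).ne')
  rw [rodgersTaoPsi_classicalLocation hy, rodgersTaoPsi_classicalLocation hy'] at hθ'
  have hgap : 0 < classicalLocation y' - classicalLocation y := sub_pos.2 hξlt
  -- `log(θ/4π)/(4π) = (y' − y)/(ξ_{y'} − ξ_y) > 0`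
  have hpos : 0 < Real.log (θ / (4 * π)) := by
    have : 0 < Real.log (θ / (4 * π)) / (4 * π) := by
      rw [hθ']; exact div_pos (by linarith) hgap
    have h := mul_pos this hπ
    rwa [div_mul_cancel₀ _ hπ.ne'] at h
  refine ⟨θ, hθ.1, hθ.2, hpos, ?_⟩
  have hne : classicalLocation y' - classicalLocation y ≠ 0 := hgap.ne'
  field_simp at hθ'
  field_simp
  linarith

/-! ## Lemma 3.1 (i): `ξ_j = (1 + o(1)) 4πj/log₊ j` -/

/-- The two-sided comparison behind (43): for every `ε > 0` there is `U₀ ≥ 1` such that for all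
`u ≥ U₀`, writing `L = log u`, `(1 − ε)(L − 1) ≤ log(2 + u(L − 1)) ≤ (1 + ε)(L − 1)` (and `2 ≤ L`).
This is the printed «`log₊ ξ_j = (1 + o(1)) log₊ j`» step in the variable `u = ξ/4π`.
[cite: RodgersTaoFMP2020, Lemma 3.1 (i) (proof) = Lemma 8 pp.21–22] -/
theorem log_two_add_mul_bounds {ε : ℝ} (hε : 0 < ε) :
    ∃ U₀ : ℝ, 1 ≤ U₀ ∧ ∀ u : ℝ, U₀ ≤ u →
      2 ≤ Real.log u ∧
      (1 - ε) * (Real.log u - 1) ≤ Real.log (2 + u * (Real.log u - 1)) ∧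
        Real.log (2 + u * (Real.log u - 1)) ≤ (1 + ε) * (Real.log u - 1) := by
  set L₀ : ℝ := (4 / ε + 2) ^ 2 with hL₀
  have hL₀4 : 4 ≤ L₀ := by
    have : (2 : ℝ) ≤ 4 / ε + 2 := by have := div_pos (by norm_num : (0:ℝ) < 4) hε; linarith
    rw [hL₀]; nlinarith
  refine ⟨Real.exp L₀, Real.one_le_exp (by linarith), fun u hu ↦ ?_⟩
  have hu0 : 0 < u := (Real.exp_pos L₀).trans_le hu
  set L : ℝ := Real.log u with hL
  have hLL₀ : L₀ ≤ L := by
    rw [hL, ← Real.log_exp L₀]; exact Real.log_le_log (Real.exp_pos _) hu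
  have hL2 : 2 ≤ L := by linarith
  have hu2 : 2 ≤ u := by
    have : Real.exp L₀ ≥ L₀ + 1 := Real.add_one_le_exp L₀
    linarith
  refine ⟨hL2, ?_, ?_⟩
  · -- lower: `log(2 + u(L−1)) ≥ log(u(L−1)) = L + log(L−1) ≥ L − 1 ≥ (1−ε)(L−1)`
    have hprod : 0 < u * (L - 1) := mul_pos hu0 (by linarith)
    have h1 : Real.log (u * (L - 1)) ≤ Real.log (2 + u * (L - 1)) :=
      Real.log_le_log hprod (by linarith)
    have h2 : Real.log (u * (L - 1)) = L + Real.log (L - 1) := by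
      rw [Real.log_mul hu0.ne' (by linarith : L - 1 ≠ 0), hL]
    have h3 : 0 ≤ Real.log (L - 1) := Real.log_nonneg (by linarith)
    have h4 : (1 - ε) * (L - 1) ≤ L - 1 := by nlinarith
    linarith
  · -- upper: `log(2 + u(L−1)) ≤ log(uL) = L + log L ≤ L + 2√L ≤ (1+ε)(L−1)`
    have hle : 2 + u * (L - 1) ≤ u * L := by nlinarith
    have hpos : 0 < 2 + u * (L - 1) := by nlinarith
    have h1 : Real.log (2 + u * (L - 1)) ≤ Real.log (u * L) := Real.log_le_log hpos hle
    have h2 : Real.log (u * L) = L + Real.log L := by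
      rw [Real.log_mul hu0.ne' (by linarith : L ≠ 0), hL]
    -- `log L ≤ 2(√L − 1)`
    have hsq : 0 < Real.sqrt L := Real.sqrt_pos.2 (by linarith)
    have hsqL : Real.sqrt L * Real.sqrt L = L := Real.mul_self_sqrt (by linarith)
    have h3 : Real.log L ≤ 2 * (Real.sqrt L - 1) := by
      have := Real.log_le_sub_one_of_pos hsq
      have hlog : Real.log L = 2 * Real.log (Real.sqrt L) := by
        conv_lhs => rw [← hsqL]
        rw [Real.log_mul hsq.ne' hsq.ne']; ring
      rw [hlog]; linarith
    -- `√L ≥ 4/ε + 2`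
    have h4 : 4 / ε + 2 ≤ Real.sqrt L := by
      have : Real.sqrt L₀ = 4 / ε + 2 := by
        rw [hL₀, Real.sqrt_sq (by have := div_pos (by norm_num : (0:ℝ) < 4) hε; linarith)]
      rw [← this]; exact Real.sqrt_le_sqrt hLL₀
    -- hence `ε L = ε √L √L ≥ (4 + 2ε) √L ≥ 2√L + 1 + ε + …`
    have h5 : (4 + 2 * ε) * Real.sqrt L ≤ ε * L := by
      have : (4 / ε + 2) * ε = 4 + 2 * ε := by field_simp
      calc (4 + 2 * ε) * Real.sqrt L = ((4 / ε + 2) * ε) * Real.sqrt L := by rw [this]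
        _ ≤ (Real.sqrt L * ε) * Real.sqrt L := by
            apply mul_le_mul_of_nonneg_right _ hsq.le
            exact mul_le_mul_of_nonneg_right h4 hε.le
        _ = ε * L := by rw [mul_comm (Real.sqrt L) ε, mul_assoc, hsqL]
    have h6 : 1 ≤ Real.sqrt L := by
      have : (2 : ℝ) ≤ 4 / ε + 2 := by have := div_pos (by norm_num : (0:ℝ) < 4) hε; linarith
      linarith
    nlinarith

/-- **Lemma 3.1 (i) holds** (eq. (43)): CONTENT discharge of `lemma31_i`. With `u = ξ_j/4π` and
`L = log u` one has `j = Ψ(ξ_j) = u(L − 1)`, so `ξ_j log₊ j/(4πj) = log(2 + u(L−1))/(L − 1)`, and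
`log_two_add_mul_bounds` gives `|… − 1| ≤ ε` once `ξ_j ≥ 4πU₀`, i.e. once `j ≥ Ψ(4πU₀)`.
[cite: RodgersTaoFMP2020, Lemma 3.1 (i) = Lemma 8 (i) eq. (43) p.21] -/
theorem lemma31_i_holds : lemma31_i := by
  intro ε hε
  obtain ⟨U₀, hU₀, hU⟩ := log_two_add_mul_bounds hε
  have hπ : 0 < 4 * π := by positivity
  have hX : 4 * π ≤ 4 * π * U₀ := by nlinarith
  refine ⟨rodgersTaoPsi (4 * π * U₀), fun j hj1 hj ↦ ?_⟩
  have hj' : (-1 : ℝ) ≤ j := by linarith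
  set ξ : ℝ := classicalLocation j with hξdef
  have hξX : 4 * π * U₀ ≤ ξ := (le_classicalLocation_iff_rodgersTaoPsi_le hj' hX).2 hj
  set u : ℝ := ξ / (4 * π) with hudef
  have huU : U₀ ≤ u := by rw [hudef, le_div_iff₀ hπ]; linarith
  obtain ⟨hL2, hlo, hhi⟩ := hU u huU
  set L : ℝ := Real.log u with hLdef
  have hΨ : rodgersTaoPsi ξ = j := rodgersTaoPsi_classicalLocation hj'
  have hj_eq : j = u * (L - 1) := by rw [← hΨ, rodgersTaoPsi_eq_mul]
  have hL1 : 0 < L - 1 := by linarith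
  have hu0 : 0 < u := lt_of_lt_of_le (by linarith) huU
  have hj0 : 0 < j := by linarith
  -- the ratio is `log₊ j/(L − 1)`
  have hξu : ξ = 4 * π * u := by rw [hudef]; field_simp
  have hratio : ξ * logPlus j / (4 * π * j) = Real.log (2 + u * (L - 1)) / (L - 1) := by
    rw [logPlus_of_nonneg hj0.le, hj_eq, hξu]
    field_simp
  rw [hratio, div_sub_one hL1.ne', abs_div, abs_of_pos hL1, div_le_iff₀ hL1, abs_le]
  constructor <;> nlinarith

/-! ## Lemma 3.1 (i), «in particular»: `ξ_j ≍ j/log₊ j` and `log₊ ξ_j ≍ log₊ j` -/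

/-- Crude polynomial lower bound: `y ≤ ξ_y²` for `y ≥ 1` (from `y = Ψ(ξ_y) ≤ ξ_y log ξ_y` and
`log ξ ≤ ξ`); the printed «`j^{1/2} ≪ ξ_j`». [cite: RodgersTaoFMP2020, Lemma 3.1 (i) (proof) = Lemma 8 p.21] -/
theorem le_classicalLocation_sq {y : ℝ} (hy : 1 ≤ y) : y ≤ classicalLocation y ^ 2 := by
  have hy' : (-1 : ℝ) ≤ y := by linarith
  have h4 := four_pi_le_classicalLocation hy'
  have hξ : 0 < classicalLocation y := classicalLocation_pos hy'
  have h1 : y ≤ classicalLocation y * Real.log (classicalLocation y) := by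
    have := rodgersTaoPsi_le_mul_log h4
    rwa [rodgersTaoPsi_classicalLocation hy'] at this
  have h2 : Real.log (classicalLocation y) ≤ classicalLocation y :=
    (Real.log_le_sub_one_of_pos hξ).trans (by linarith)
  nlinarith

/-- `log₊ y ≤ 3 log₊ ξ_y` for `y ≥ 1` (the printed «`log₊ ξ_j ≍ log₊ j`», lower half, with an
explicit constant: `log(2 + y) ≤ log 3 + 2 log ξ_y ≤ 3 log₊ ξ_y`).
[cite: RodgersTaoFMP2020, Lemma 3.1 (i) = Lemma 8 (i) p.21] -/
theorem logPlus_le_three_mul_logPlus_classicalLocation {y : ℝ} (hy : 1 ≤ y) :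
    logPlus y ≤ 3 * logPlus (classicalLocation y) := by
  have hξ1 := one_lt_classicalLocation hy
  have hξ : 0 < classicalLocation y := by linarith
  have hsq := le_classicalLocation_sq hy
  have h1 : logPlus y ≤ Real.log 3 + Real.log y := by
    rw [logPlus_of_nonneg (by linarith), ← Real.log_mul (by norm_num) (by linarith)]
    exact Real.log_le_log (by linarith) (by linarith)
  have h2 : Real.log y ≤ 2 * Real.log (classicalLocation y) := by
    rw [← Real.log_rpow hξ, Real.rpow_two]
    exact Real.log_le_log (by linarith) hsq
  have h3 : Real.log (classicalLocation y) ≤ logPlus (classicalLocation y) := log_le_logPlus hξ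
  have h4 : Real.log 3 ≤ logPlus (classicalLocation y) := by
    rw [logPlus_of_nonneg hξ.le]
    exact Real.log_le_log (by norm_num) (by linarith)
  linarith

/-- **Lemma 3.1 (i), «in particular» clause, holds**: CONTENT discharge of `lemma31_i_order`
(`ξ_j ≍ j/log₊ j` and `log₊ ξ_j ≍ log₊ j` for all real `j ≥ 1`, one pair of absolute constants).
From (43) with `ε = ½` beyond a threshold `j₁`, monotonicity of `ξ` and of `log₊` on `[1, j₁]`,
and the crude bounds `j ≤ ξ_j²`, `ξ_j ≤ 2C₁ j`.
[cite: RodgersTaoFMP2020, Lemma 3.1 (i) = Lemma 8 (i) p.21] -/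
theorem lemma31_i_order_holds : lemma31_i_order := by
  obtain ⟨j₀, hj₀⟩ := lemma31_i_holds (1 / 2) (by norm_num)
  have hπ : 0 < π := Real.pi_pos
  have hlog2 : (1 : ℝ) / 2 < Real.log 2 := by have := Real.log_two_gt_d9; linarith
  set j₁ : ℝ := max 1 j₀ with hj₁
  have hj₁1 : 1 ≤ j₁ := le_max_left _ _
  have hj₁0 : 0 < j₁ := by linarith
  -- beyond `j₁`: `2π j/log₊ j ≤ ξ_j ≤ 6π j/log₊ j`
  have hfar : ∀ j : ℝ, j₁ ≤ j →
      2 * π * (j / logPlus j) ≤ classicalLocation j ∧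
        classicalLocation j ≤ 6 * π * (j / logPlus j) := by
    intro j hj
    have hj1 : 1 ≤ j := hj₁1.trans hj
    have hj0 : 0 < j := by linarith
    have hlp := logPlus_pos j
    have hr := hj₀ j hj1 ((le_max_right _ _).trans hj)
    rw [abs_le] at hr
    obtain ⟨h1, h2⟩ := hr
    have hden : 0 < 4 * π * j := by positivity
    have hlo : 1 / 2 ≤ classicalLocation j * logPlus j / (4 * π * j) := by linarith
    have hhi : classicalLocation j * logPlus j / (4 * π * j) ≤ 3 / 2 := by linarith
    rw [le_div_iff₀ hden] at hlo
    rw [div_le_iff₀ hden] at hhi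
    constructor
    · rw [show 2 * π * (j / logPlus j) = 2 * π * j / logPlus j by ring, div_le_iff₀ hlp]
      linarith
    · rw [show 6 * π * (j / logPlus j) = 6 * π * j / logPlus j by ring, le_div_iff₀ hlp]
      linarith
  -- the constants for `ξ_j ≍ j/log₊ j`
  set c₁ : ℝ := min (2 * π) (4 * π * Real.log 2 / j₁) with hc₁
  set C₁ : ℝ := max (6 * π) (classicalLocation j₁ * logPlus j₁) with hC₁
  have hc₁pos : 0 < c₁ := lt_min (by positivity) (by positivity)
  have hC₁6 : 6 * π ≤ C₁ := le_max_left _ _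
  have hC₁0 : 0 ≤ C₁ := le_trans (by positivity) hC₁6
  have hlow : ∀ j : ℝ, 1 ≤ j → c₁ * (j / logPlus j) ≤ classicalLocation j := by
    intro j hj1
    have hj0 : 0 ≤ j := by linarith
    have hlp := logPlus_pos j
    rcases le_or_gt j₁ j with hfarj | hnear
    · exact le_trans (mul_le_mul_of_nonneg_right (min_le_left _ _) (by positivity)) (hfar j hfarj).1
    · -- `c₁ (j/log₊ j) ≤ (4π log 2/j₁)(j₁/log 2) = 4π ≤ ξ_j`
      have hq : j / logPlus j ≤ j₁ / Real.log 2 := by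
        rw [div_le_div_iff₀ hlp (by linarith)]
        calc j * Real.log 2 ≤ j * logPlus j :=
              mul_le_mul_of_nonneg_left (log_two_le_logPlus j) hj0
          _ ≤ j₁ * logPlus j := mul_le_mul_of_nonneg_right hnear.le hlp.le
      calc c₁ * (j / logPlus j) ≤ (4 * π * Real.log 2 / j₁) * (j₁ / Real.log 2) :=
            mul_le_mul (min_le_right _ _) hq (by positivity) (by positivity)
        _ = 4 * π := by field_simp
        _ ≤ classicalLocation j := four_pi_le_classicalLocation (by linarith)
  have hupp : ∀ j : ℝ, 1 ≤ j → classicalLocation j ≤ C₁ * (j / logPlus j) := by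
    intro j hj1
    have hj0 : 0 ≤ j := by linarith
    have hlp := logPlus_pos j
    rcases le_or_gt j₁ j with hfarj | hnear
    · exact (hfar j hfarj).2.trans (mul_le_mul_of_nonneg_right hC₁6 (by positivity))
    · -- `ξ_j ≤ ξ_{j₁} = (ξ_{j₁} log₊ j₁)/log₊ j₁ ≤ (ξ_{j₁} log₊ j₁) (j/log₊ j)`
      have hmono : classicalLocation j ≤ classicalLocation j₁ :=
        (classicalLocation_le_iff (by linarith) (by linarith)).2 hnear.le
      have hlp₁ := logPlus_pos j₁
      have hξ₁ : 0 ≤ classicalLocation j₁ := (classicalLocation_pos (by linarith)).le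
      have hq : 1 / logPlus j₁ ≤ j / logPlus j := by
        rw [div_le_div_iff₀ hlp₁ hlp, one_mul]
        have hlpmono : logPlus j ≤ logPlus j₁ :=
          logPlus_le_logPlus (by rw [abs_of_nonneg hj0, abs_of_nonneg hj₁0.le]; exact hnear.le)
        calc logPlus j ≤ logPlus j₁ := hlpmono
          _ = 1 * logPlus j₁ := (one_mul _).symm
          _ ≤ j * logPlus j₁ := mul_le_mul_of_nonneg_right hj1 hlp₁.le
      calc classicalLocation j ≤ classicalLocation j₁ := hmono
        _ = (classicalLocation j₁ * logPlus j₁) * (1 / logPlus j₁) := by field_simp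
        _ ≤ (classicalLocation j₁ * logPlus j₁) * (j / logPlus j) :=
            mul_le_mul_of_nonneg_left hq (by positivity)
        _ ≤ C₁ * (j / logPlus j) := mul_le_mul_of_nonneg_right (le_max_right _ _) (by positivity)
  -- the constants for `log₊ ξ_j ≍ log₊ j`
  set C₂ : ℝ := 1 + Real.log (2 + 2 * C₁) / Real.log 2 with hC₂
  have hC₂1 : 1 ≤ C₂ := by
    have : 0 ≤ Real.log (2 + 2 * C₁) / Real.log 2 :=
      div_nonneg (Real.log_nonneg (by linarith)) (by linarith)
    linarith
  have hloghi : ∀ j : ℝ, 1 ≤ j → logPlus (classicalLocation j) ≤ C₂ * logPlus j := by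
    intro j hj1
    have hj0 : 0 ≤ j := by linarith
    have hlp := logPlus_pos j
    have hξ : 0 < classicalLocation j := classicalLocation_pos (by linarith)
    -- `ξ_j ≤ C₁ j/log₊ j ≤ 2 C₁ j`
    have hξle : classicalLocation j ≤ 2 * C₁ * j := by
      have h := hupp j hj1
      have : j / logPlus j ≤ 2 * j := by
        rw [div_le_iff₀ hlp]
        have := log_two_le_logPlus j
        nlinarith
      nlinarith
    have hkey : 2 + classicalLocation j ≤ (2 + 2 * C₁) * (2 + j) := by nlinarith
    have h1 : logPlus (classicalLocation j) ≤ Real.log (2 + 2 * C₁) + logPlus j := by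
      rw [logPlus_of_nonneg hξ.le, logPlus_of_nonneg hj0, ← Real.log_mul (by linarith) (by linarith)]
      exact Real.log_le_log (by linarith) hkey
    have h2 : Real.log (2 + 2 * C₁) ≤ Real.log (2 + 2 * C₁) / Real.log 2 * logPlus j := by
      rw [div_mul_eq_mul_div, le_div_iff₀ (by linarith)]
      exact mul_le_mul_of_nonneg_left (log_two_le_logPlus j) (Real.log_nonneg (by linarith))
    calc logPlus (classicalLocation j) ≤ Real.log (2 + 2 * C₁) + logPlus j := h1
      _ ≤ Real.log (2 + 2 * C₁) / Real.log 2 * logPlus j + logPlus j := by linarith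
      _ = C₂ * logPlus j := by rw [hC₂]; ring
  -- assemble with `c = min c₁ (1/3)`, `C = max C₁ C₂`
  refine ⟨min c₁ (1 / 3), max C₁ C₂, lt_min hc₁pos (by norm_num), ?_, fun j hj1 ↦ ⟨?_, ?_, ?_, ?_⟩⟩
  · exact (min_le_right _ _).trans ((by linarith [Real.pi_gt_three]) : (1:ℝ)/3 ≤ 6 * π)
      |>.trans (hC₁6.trans (le_max_left _ _))
  · have hlp := logPlus_pos j
    exact le_trans (mul_le_mul_of_nonneg_right (min_le_left _ _) (by positivity : 0 ≤ j / logPlus j))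
      (hlow j hj1)
  · have hlp := logPlus_pos j
    exact (hupp j hj1).trans (mul_le_mul_of_nonneg_right (le_max_left _ _) (by positivity))
  · have h := logPlus_le_three_mul_logPlus_classicalLocation hj1
    have hlp := logPlus_pos j
    calc min c₁ (1 / 3) * logPlus j ≤ 1 / 3 * logPlus j :=
          mul_le_mul_of_nonneg_right (min_le_right _ _) hlp.le
      _ ≤ logPlus (classicalLocation j) := by linarith
  · have hlp := logPlus_pos j
    exact (hloghi j hj1).trans (mul_le_mul_of_nonneg_right (le_max_right _ _) hlp.le)

/-! ## Lemma 3.1 (iii) (corrected (45)): `ξ_k − ξ_j = 4π(k−j)/log(ξ_j/4π) + O((k−j)²/(j log² ξ_j))` -/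

/-- The forward case `j < k` of (45): `|ξ_k − ξ_j − 4π(k−j)/ℓ_j| ≤ 4π(k−j)²/(j ℓ_j²)` with
`ℓ_j = log(ξ_j/4π)` (no comparability hypothesis is needed in this direction). Mean value theorem,
`log(θ/ξ_j) ≤ (θ − ξ_j)/ξ_j` and `ξ_j ℓ_j ≥ 4πj`.
[cite: RodgersTaoFMP2020, Lemma 3.1 (iii) (proof) = Lemma 8 p.22] -/
theorem lemma31_iii_forward {j k : ℝ} (hj : 1 ≤ j) (hlt : j < k) :
    |classicalLocation k - classicalLocation j -
        4 * π * (k - j) / Real.log (classicalLocation j / (4 * π))| ≤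
      4 * π * ((k - j) ^ 2 / (j * Real.log (classicalLocation j / (4 * π)) ^ 2)) := by
  have hπ : 0 < 4 * π := by positivity
  obtain ⟨θ, hθ1, hθ2, hℓθ, hgap⟩ := exists_mvt_classicalLocation (by linarith : (-1:ℝ) ≤ j) hlt
  set ξj := classicalLocation j with hξj
  set ξk := classicalLocation k with hξk
  set ℓj := Real.log (ξj / (4 * π)) with hℓjdef
  set ℓθ := Real.log (θ / (4 * π)) with hℓθdef
  have hℓj1 : 1 < ℓj := one_lt_log_classicalLocation_div hj
  have hℓj0 : 0 < ℓj := by linarith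
  have hξj0 : 0 < ξj := classicalLocation_pos (by linarith)
  have hθ0 : 0 < θ := hξj0.trans hθ1
  have hkj : 0 < k - j := sub_pos.2 hlt
  -- `ℓ_j ≤ ℓ_θ` and `ℓ_θ − ℓ_j = log(θ/ξ_j) ≤ (θ − ξ_j)/ξ_j ≤ (ξ_k − ξ_j)/ξ_j`
  have hℓle : ℓj ≤ ℓθ := Real.log_le_log (div_pos hξj0 hπ) (by
    rw [div_le_div_iff_of_pos_right hπ]; exact hθ1.le)
  have hdiff : ℓθ - ℓj ≤ (ξk - ξj) / ξj := by
    have h1 : ℓθ - ℓj = Real.log (θ / ξj) := by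
      rw [hℓθdef, hℓjdef, Real.log_div hθ0.ne' hπ.ne', Real.log_div hξj0.ne' hπ.ne',
        Real.log_div hθ0.ne' hξj0.ne']; ring
    rw [h1]
    calc Real.log (θ / ξj) ≤ θ / ξj - 1 := Real.log_le_sub_one_of_pos (div_pos hθ0 hξj0)
      _ = (θ - ξj) / ξj := by field_simp
      _ ≤ (ξk - ξj) / ξj := div_le_div_of_nonneg_right (by linarith) hξj0.le
  -- `ξ_k − ξ_j = 4π(k−j)/ℓ_θ ≤ 4π(k−j)/ℓ_j`
  have hgap_le : ξk - ξj ≤ 4 * π * (k - j) / ℓj := by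
    rw [hgap]; exact div_le_div_of_nonneg_left (by positivity) hℓj0 hℓle
  have hdiff' : ℓθ - ℓj ≤ 4 * π * (k - j) / (ℓj * ξj) := by
    calc ℓθ - ℓj ≤ (ξk - ξj) / ξj := hdiff
      _ ≤ (4 * π * (k - j) / ℓj) / ξj := div_le_div_of_nonneg_right hgap_le hξj0.le
      _ = 4 * π * (k - j) / (ℓj * ξj) := by rw [div_div]
  -- the deviation, exactly
  have hD : ξk - ξj - 4 * π * (k - j) / ℓj = -(4 * π * (k - j) * ((ℓθ - ℓj) / (ℓθ * ℓj))) := by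
    rw [hgap]; field_simp; ring
  have hDabs : |ξk - ξj - 4 * π * (k - j) / ℓj| = 4 * π * (k - j) * ((ℓθ - ℓj) / (ℓθ * ℓj)) := by
    rw [hD, abs_neg, abs_of_nonneg]
    exact mul_nonneg (by positivity) (div_nonneg (by linarith) (by positivity))
  -- `ξ_j ℓ_j ≥ 4π j`
  have hjℓ : 4 * π * j ≤ ξj * ℓj := four_pi_mul_le_classicalLocation_mul_log hj
  rw [hDabs]
  calc 4 * π * (k - j) * ((ℓθ - ℓj) / (ℓθ * ℓj))
      ≤ 4 * π * (k - j) * ((ℓθ - ℓj) / (ℓj * ℓj)) := by gcongr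
    _ ≤ 4 * π * (k - j) * ((4 * π * (k - j) / (ℓj * ξj)) / (ℓj * ℓj)) := by gcongr
    _ = (4 * π * (k - j)) ^ 2 / (ℓj ^ 2 * (ξj * ℓj)) := by field_simp
    _ ≤ (4 * π * (k - j)) ^ 2 / (ℓj ^ 2 * (4 * π * j)) := by gcongr
    _ = 4 * π * ((k - j) ^ 2 / (j * ℓj ^ 2)) := by field_simp

/-- The backward case `k < j ≤ K k` of (45): if moreover `ℓ_j ≤ M ℓ_k` (`ℓ = log(ξ/4π)`, `M ≥ 1`),
then `|ξ_k − ξ_j − 4π(k−j)/ℓ_j| ≤ 4πKM (k−j)²/(j ℓ_j²)`. Mean value theorem as in the forward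
case, with `ξ_k ℓ_k ≥ 4πk ≥ 4πj/K`. [cite: RodgersTaoFMP2020, Lemma 3.1 (iii) (proof) = Lemma 8 p.22] -/
theorem lemma31_iii_backward {j k K M : ℝ} (hk : 1 ≤ k) (hlt : k < j) (hK : j ≤ K * k)
    (hM1 : 1 ≤ M)
    (hM : Real.log (classicalLocation j / (4 * π)) ≤ M * Real.log (classicalLocation k / (4 * π))) :
    |classicalLocation k - classicalLocation j -
        4 * π * (k - j) / Real.log (classicalLocation j / (4 * π))| ≤
      4 * π * K * M * ((k - j) ^ 2 / (j * Real.log (classicalLocation j / (4 * π)) ^ 2)) := by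
  have hπ : 0 < 4 * π := by positivity
  have hj : 1 ≤ j := by linarith
  obtain ⟨θ, hθ1, hθ2, hℓθ, hgap⟩ := exists_mvt_classicalLocation (by linarith : (-1:ℝ) ≤ k) hlt
  set ξj := classicalLocation j with hξj
  set ξk := classicalLocation k with hξk
  set ℓj := Real.log (ξj / (4 * π)) with hℓjdef
  set ℓk := Real.log (ξk / (4 * π)) with hℓkdef
  set ℓθ := Real.log (θ / (4 * π)) with hℓθdef
  have hℓj1 : 1 < ℓj := one_lt_log_classicalLocation_div hj
  have hℓk1 : 1 < ℓk := one_lt_log_classicalLocation_div hk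
  have hℓj0 : 0 < ℓj := by linarith
  have hℓk0 : 0 < ℓk := by linarith
  have hξk0 : 0 < ξk := classicalLocation_pos (by linarith)
  have hξj0 : 0 < ξj := classicalLocation_pos (by linarith)
  have hθ0 : 0 < θ := hξk0.trans hθ1
  have hjk : 0 < j - k := sub_pos.2 hlt
  have hK1 : 1 ≤ K := by nlinarith
  have hK0 : 0 < K := by linarith
  -- `ℓ_k ≤ ℓ_θ ≤ ℓ_j`
  have hℓkθ : ℓk ≤ ℓθ := Real.log_le_log (div_pos hξk0 hπ) (by
    rw [div_le_div_iff_of_pos_right hπ]; exact hθ1.le)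
  have hℓθj : ℓθ ≤ ℓj := Real.log_le_log (div_pos hθ0 hπ) (by
    rw [div_le_div_iff_of_pos_right hπ]; exact hθ2.le)
  -- `ℓ_j − ℓ_θ = log(ξ_j/θ) ≤ (ξ_j − θ)/θ ≤ (ξ_j − ξ_k)/ξ_k ≤ 4π(j−k)/(ℓ_k ξ_k)`
  have hdiff : ℓj - ℓθ ≤ 4 * π * (j - k) / (ℓk * ξk) := by
    have h1 : ℓj - ℓθ = Real.log (ξj / θ) := by
      rw [hℓθdef, hℓjdef, Real.log_div hθ0.ne' hπ.ne', Real.log_div hξj0.ne' hπ.ne',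
        Real.log_div hξj0.ne' hθ0.ne']; ring
    have hgap_le : ξj - ξk ≤ 4 * π * (j - k) / ℓk := by
      rw [hgap]; exact div_le_div_of_nonneg_left (by positivity) hℓk0 hℓkθ
    rw [h1]
    calc Real.log (ξj / θ) ≤ ξj / θ - 1 := Real.log_le_sub_one_of_pos (div_pos hξj0 hθ0)
      _ = (ξj - θ) / θ := by field_simp
      _ ≤ (ξj - ξk) / ξk := by
          rw [div_le_div_iff₀ hθ0 hξk0]; nlinarith
      _ ≤ (4 * π * (j - k) / ℓk) / ξk := div_le_div_of_nonneg_right hgap_le hξk0.le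
      _ = 4 * π * (j - k) / (ℓk * ξk) := by rw [div_div]
  -- the deviation, exactly
  have hD : ξk - ξj - 4 * π * (k - j) / ℓj = -(4 * π * (j - k) * ((ℓj - ℓθ) / (ℓθ * ℓj))) := by
    have : ξk - ξj = -(4 * π * (j - k) / ℓθ) := by rw [← hgap]; ring
    rw [this]; field_simp; ring
  have hDabs : |ξk - ξj - 4 * π * (k - j) / ℓj| = 4 * π * (j - k) * ((ℓj - ℓθ) / (ℓθ * ℓj)) := by
    rw [hD, abs_neg, abs_of_nonneg]
    exact mul_nonneg (by positivity) (div_nonneg (by linarith) (by positivity))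
  -- `ξ_k ℓ_k ≥ 4π k ≥ 4π j / K`
  have hkℓ : 4 * π * k ≤ ξk * ℓk := four_pi_mul_le_classicalLocation_mul_log hk
  have hkℓ' : 4 * π * j / K ≤ ξk * ℓk := by
    rw [div_le_iff₀ hK0]; nlinarith
  have hℓk_lo : ℓj / M ≤ ℓk := by rw [div_le_iff₀ (by linarith)]; linarith
  rw [hDabs]
  calc 4 * π * (j - k) * ((ℓj - ℓθ) / (ℓθ * ℓj))
      ≤ 4 * π * (j - k) * ((ℓj - ℓθ) / (ℓk * ℓj)) := by gcongr
    _ ≤ 4 * π * (j - k) * ((4 * π * (j - k) / (ℓk * ξk)) / (ℓk * ℓj)) := by gcongr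
    _ = (4 * π * (j - k)) ^ 2 / ((ξk * ℓk) * ℓk * ℓj) := by field_simp
    _ ≤ (4 * π * (j - k)) ^ 2 / ((4 * π * j / K) * (ℓj / M) * ℓj) := by gcongr
    _ = 4 * π * K * M * ((k - j) ^ 2 / (j * ℓj ^ 2)) := by field_simp; ring

/-- **Lemma 3.1 (iii) holds** (eq. (45), corrected main term `4π(k−j)/log(ξ_j/4π)`): CONTENT
discharge of `lemma31_iii`, with `A = 64πK(1 + log(CK/c))` where `c, C` are the constants of
`lemma31_i_order_holds` (`ξ_j ≍ j/log₊ j` converts `j ≤ Kk` into `log(ξ_j/4π) ≤ (1 + log(CK/c))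
log(ξ_k/4π)`, and `log ξ_j ≤ 4 log(ξ_j/4π)` converts `ℓ_j²` into the printed `log² ξ_j`).
[cite: RodgersTaoFMP2020, Lemma 3.1 (iii) = Lemma 8 (iii) eq. (45) p.21] -/
theorem lemma31_iii_holds : lemma31_iii := by
  intro K hK1
  obtain ⟨c, C, hc, hcC, hord⟩ := lemma31_i_order_holds
  have hπ : 0 < 4 * π := by positivity
  have hK0 : 0 < K := by linarith
  have hC0 : 0 < C := hc.trans_le hcC
  have hR : 1 ≤ C * K / c := by
    rw [le_div_iff₀ hc]; nlinarith
  set M : ℝ := 1 + Real.log (C * K / c) with hM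
  have hM1 : 1 ≤ M := by have := Real.log_nonneg hR; linarith
  refine ⟨64 * π * K * M, fun j k hj hk hjk hkj ↦ ?_⟩
  set ξj := classicalLocation j with hξj
  set ℓj := Real.log (ξj / (4 * π)) with hℓjdef
  have hℓj1 : 1 < ℓj := one_lt_log_classicalLocation_div hj
  have hℓj0 : 0 < ℓj := by linarith
  have hj0 : 0 < j := by linarith
  -- `ℓ_j² ≥ log² ξ_j / 16`
  have hlog4 : Real.log ξj ≤ 4 * ℓj := log_classicalLocation_le hj
  have hlog0 : 0 < Real.log ξj := Real.log_pos (one_lt_classicalLocation hj)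
  have hconv : (k - j) ^ 2 / (j * ℓj ^ 2) ≤ 16 * ((k - j) ^ 2 / (j * Real.log ξj ^ 2)) := by
    rw [div_le_iff₀ (by positivity)]
    calc (k - j) ^ 2 = 16 * ((k - j) ^ 2 / (j * Real.log ξj ^ 2)) * (j * (Real.log ξj / 4) ^ 2) := by
          field_simp; ring
      _ ≤ 16 * ((k - j) ^ 2 / (j * Real.log ξj ^ 2)) * (j * ℓj ^ 2) := by
          gcongr
          linarith
  rcases lt_trichotomy j k with hlt | heq | hgt
  · -- forward case
    have h := lemma31_iii_forward hj hlt
    calc |classicalLocation k - ξj - 4 * π * (k - j) / ℓj|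
        ≤ 4 * π * ((k - j) ^ 2 / (j * ℓj ^ 2)) := h
      _ ≤ 4 * π * (16 * ((k - j) ^ 2 / (j * Real.log ξj ^ 2))) := by gcongr
      _ = 64 * π * 1 * 1 * ((k - j) ^ 2 / (j * Real.log ξj ^ 2)) := by ring
      _ ≤ 64 * π * K * M * ((k - j) ^ 2 / (j * Real.log ξj ^ 2)) := by
          gcongr
  · subst heq
    simp [hξj]
  · -- backward case: first `ℓ_j ≤ M ℓ_k` from `ξ_j ≤ (CK/c) ξ_k`
    set ξk := classicalLocation k with hξk
    set ℓk := Real.log (ξk / (4 * π)) with hℓkdef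
    have hℓk1 : 1 < ℓk := one_lt_log_classicalLocation_div hk
    have hξk0 : 0 < ξk := classicalLocation_pos (by linarith)
    have hξj0 : 0 < ξj := classicalLocation_pos (by linarith)
    have hk0 : 0 < k := by linarith
    obtain ⟨-, hjup, -, -⟩ := hord j hj
    obtain ⟨hklo, -, -, -⟩ := hord k hk
    have hlpk := logPlus_pos k
    have hlpmono : logPlus k ≤ logPlus j :=
      logPlus_le_logPlus (by rw [abs_of_pos hk0, abs_of_pos hj0]; exact hgt.le)
    have hratio : ξj ≤ C * K / c * ξk := by
      -- `ξ_j ≤ C j/log₊ j ≤ C K k/log₊ k ≤ (CK/c) ξ_k`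
      have h1 : j / logPlus j ≤ K * (k / logPlus k) := by
        rw [mul_div_assoc', div_le_div_iff₀ (logPlus_pos j) hlpk]
        calc j * logPlus k ≤ K * k * logPlus k := by nlinarith
          _ ≤ K * k * logPlus j := by nlinarith
      have h2 : k / logPlus k ≤ ξk / c := by
        rw [le_div_iff₀ hc]; linarith
      calc ξj ≤ C * (j / logPlus j) := hjup
        _ ≤ C * (K * (ξk / c)) := by gcongr; exact h1.trans (by gcongr)
        _ = C * K / c * ξk := by field_simp
    have hM' : ℓj ≤ M * ℓk := by
      have h1 : ℓj ≤ Real.log (C * K / c) + ℓk := by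
        rw [hℓjdef, hℓkdef, ← Real.log_mul (by positivity) (by positivity)]
        exact Real.log_le_log (by positivity) (by
          calc ξj / (4 * π) ≤ (C * K / c * ξk) / (4 * π) := by gcongr
            _ = C * K / c * (ξk / (4 * π)) := by ring)
      have h2 : Real.log (C * K / c) ≤ Real.log (C * K / c) * ℓk := by
        have := Real.log_nonneg hR
        nlinarith
      calc ℓj ≤ Real.log (C * K / c) + ℓk := h1
        _ ≤ Real.log (C * K / c) * ℓk + ℓk := by linarith
        _ = M * ℓk := by rw [hM]; ring
    have h := lemma31_iii_backward hk hgt hjk hM1 hM'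
    calc |ξk - ξj - 4 * π * (k - j) / ℓj|
        ≤ 4 * π * K * M * ((k - j) ^ 2 / (j * ℓj ^ 2)) := h
      _ ≤ 4 * π * K * M * (16 * ((k - j) ^ 2 / (j * Real.log ξj ^ 2))) := by gcongr
      _ = 64 * π * K * M * ((k - j) ^ 2 / (j * Real.log ξj ^ 2)) := by ring

/-! ## Lemma 3.1 (ii) (eq. (44)): `|ξ_k − ξ_j| ≍ |k − j|/log₊(|ξ_j| + |ξ_k|)` on `ℤ*` -/

/-- `log₊(x + y) ≤ 2 log₊ y` for `0 ≤ x ≤ y` (`2 + x + y ≤ (2 + y)²`).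
[cite: RodgersTaoFMP2020, §1.2 p.7] -/
theorem logPlus_add_le_two_mul {x y : ℝ} (hx : 0 ≤ x) (hxy : x ≤ y) :
    logPlus (x + y) ≤ 2 * logPlus y := by
  have hy : 0 ≤ y := hx.trans hxy
  rw [logPlus_of_nonneg (by linarith), logPlus_of_nonneg hy, ← Real.log_rpow (by linarith),
    Real.rpow_two]
  exact Real.log_le_log (by linarith) (by nlinarith)

/-- `log₊ y ≤ log₊(x + y)` for `0 ≤ x`, `0 ≤ y`. [cite: RodgersTaoFMP2020, §1.2 p.7] -/
theorem logPlus_le_logPlus_add {x y : ℝ} (hx : 0 ≤ x) (hy : 0 ≤ y) :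
    logPlus y ≤ logPlus (x + y) :=
  logPlus_le_logPlus (by rw [abs_of_nonneg hy, abs_of_nonneg (by linarith)]; linarith)

/-- Same-sign part of Lemma 3.1 (ii), over real indices `a, b ≥ 1`:
`|ξ_b − ξ_a| ≍ |b − a|/log₊(ξ_a + ξ_b)`. Lower bound by the mean value theorem
(`log(θ/4π) ≤ log₊(ξ_a + ξ_b)`, constant `4π`); upper bound by the printed cases «`j ≍ k`» (mean
value theorem, `log₊(ξ_a + ξ_b) ≤ (4 + log(3 + 2C/c)) log(ξ_a/4π)`) and «`j` much larger than `k`»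
(triangle inequality and (43)). [cite: RodgersTaoFMP2020, Lemma 3.1 (ii) = Lemma 8 (ii) eq. (44) p.21] -/
theorem lemma31_ii_sameSign :
    ∃ c C : ℝ, 0 < c ∧ c ≤ C ∧ ∀ a b : ℝ, 1 ≤ a → 1 ≤ b →
      c * (|b - a| / logPlus (classicalLocation a + classicalLocation b)) ≤
          |classicalLocation b - classicalLocation a| ∧
        |classicalLocation b - classicalLocation a| ≤
          C * (|b - a| / logPlus (classicalLocation a + classicalLocation b)) := by
  obtain ⟨c, C, hc, hcC, hord⟩ := lemma31_i_order_holds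
  have hπ : 0 < 4 * π := by positivity
  have hC0 : 0 < C := hc.trans_le hcC
  set M₁ : ℝ := 4 + Real.log (3 + 2 * C / c) with hM₁
  have hM₁4 : 4 ≤ M₁ := by
    have : 0 ≤ Real.log (3 + 2 * C / c) := Real.log_nonneg (by
      have := div_nonneg (by positivity : (0:ℝ) ≤ 2 * C) hc.le; linarith)
    linarith
  set CS : ℝ := max (4 * π * M₁) (4 * C ^ 2) with hCS
  -- one-sided statement for `a < b`
  have hmain : ∀ a b : ℝ, 1 ≤ a → a < b →
      4 * π * ((b - a) / logPlus (classicalLocation a + classicalLocation b)) ≤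
          classicalLocation b - classicalLocation a ∧
        classicalLocation b - classicalLocation a ≤
          CS * ((b - a) / logPlus (classicalLocation a + classicalLocation b)) := by
    intro a b ha hab
    have hb : 1 ≤ b := by linarith
    obtain ⟨θ, hθ1, hθ2, hℓθ, hgap⟩ := exists_mvt_classicalLocation (by linarith : (-1:ℝ) ≤ a) hab
    set ξa := classicalLocation a with hξa
    set ξb := classicalLocation b with hξb
    set ℓa := Real.log (ξa / (4 * π)) with hℓadef
    set ℓθ := Real.log (θ / (4 * π)) with hℓθdef
    set L := logPlus (ξa + ξb) with hL
    have hξa1 : 1 < ξa := one_lt_classicalLocation ha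
    have hξa0 : 0 < ξa := by linarith
    have hξb0 : 0 < ξb := classicalLocation_pos (by linarith)
    have hθ0 : 0 < θ := hξa0.trans hθ1
    have hℓa1 : 1 < ℓa := one_lt_log_classicalLocation_div ha
    have hba : 0 < b - a := sub_pos.2 hab
    have hL0 : 0 < L := logPlus_pos _
    constructor
    · -- lower bound: `ℓ_θ ≤ log θ ≤ log(2 + ξ_a + ξ_b) = L`
      have hℓθL : ℓθ ≤ L := by
        rw [hℓθdef, hL, logPlus_of_nonneg (by linarith)]
        apply Real.log_le_log (div_pos hθ0 hπ)
        calc θ / (4 * π) ≤ θ := div_le_self hθ0.le one_le_four_pi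
          _ ≤ 2 + (ξa + ξb) := by linarith
      rw [hgap]
      calc 4 * π * ((b - a) / L) = 4 * π * (b - a) / L := by ring
        _ ≤ 4 * π * (b - a) / ℓθ := div_le_div_of_nonneg_left (by positivity) hℓθ hℓθL
    · rcases le_or_gt b (2 * a) with hnear | hfar
      · -- `b ≤ 2a`: `ξ_b − ξ_a ≤ 4π(b−a)/ℓ_a` and `L ≤ M₁ ℓ_a`
        have hℓaθ : ℓa ≤ ℓθ := Real.log_le_log (div_pos hξa0 hπ) (by
          rw [div_le_div_iff_of_pos_right hπ]; exact hθ1.le)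
        have hgap_le : ξb - ξa ≤ 4 * π * (b - a) / ℓa := by
          rw [hgap]; exact div_le_div_of_nonneg_left (by positivity) (by linarith) hℓaθ
        -- `ξ_b ≤ (2C/c) ξ_a`
        obtain ⟨halo, -, -, -⟩ := hord a ha
        obtain ⟨-, hbup, -, -⟩ := hord b hb
        have hlpa := logPlus_pos a
        have hlpb := logPlus_pos b
        have hlpab : logPlus a ≤ logPlus b :=
          logPlus_le_logPlus (by rw [abs_of_pos (by linarith), abs_of_pos (by linarith)]; exact hab.le)
        have hξb_le : ξb ≤ 2 * C / c * ξa := by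
          have h1 : b / logPlus b ≤ 2 * (a / logPlus a) := by
            rw [mul_div_assoc', div_le_div_iff₀ hlpb hlpa]
            calc b * logPlus a ≤ 2 * a * logPlus a := by nlinarith
              _ ≤ 2 * a * logPlus b := by nlinarith
          have h2 : a / logPlus a ≤ ξa / c := by rw [le_div_iff₀ hc]; linarith
          calc ξb ≤ C * (b / logPlus b) := hbup
            _ ≤ C * (2 * (ξa / c)) := by gcongr; exact h1.trans (by gcongr)
            _ = 2 * C / c * ξa := by field_simp
        have hLle : L ≤ M₁ * ℓa := by
          have h1 : 2 + (ξa + ξb) ≤ (3 + 2 * C / c) * ξa := by nlinarith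
          have h2 : L ≤ Real.log (3 + 2 * C / c) + Real.log ξa := by
            rw [hL, logPlus_of_nonneg (by linarith), ← Real.log_mul (by positivity) hξa0.ne']
            exact Real.log_le_log (by linarith) h1
          have h3 : Real.log ξa ≤ 4 * ℓa := log_classicalLocation_le ha
          have h4 : Real.log (3 + 2 * C / c) ≤ Real.log (3 + 2 * C / c) * ℓa := by
            have : 0 ≤ Real.log (3 + 2 * C / c) := Real.log_nonneg (by
              have := div_nonneg (by positivity : (0:ℝ) ≤ 2 * C) hc.le; linarith)
            nlinarith
          calc L ≤ Real.log (3 + 2 * C / c) + Real.log ξa := h2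
            _ ≤ Real.log (3 + 2 * C / c) * ℓa + 4 * ℓa := by linarith
            _ = M₁ * ℓa := by rw [hM₁]; ring
        calc ξb - ξa ≤ 4 * π * (b - a) / ℓa := hgap_le
          _ = 4 * π * (b - a) * M₁ / (M₁ * ℓa) := by field_simp
          _ ≤ 4 * π * (b - a) * M₁ / L := div_le_div_of_nonneg_left (by positivity) hL0 hLle
          _ = 4 * π * M₁ * ((b - a) / L) := by ring
          _ ≤ CS * ((b - a) / L) := by gcongr; exact le_max_left _ _
      · -- `b > 2a`: `ξ_b − ξ_a ≤ ξ_b ≤ C b/log₊ b` and `(b − a)/L ≥ b/(4C log₊ b)`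
        obtain ⟨-, hbup, -, hblog⟩ := hord b hb
        have hlpb := logPlus_pos b
        have hξab : ξa ≤ ξb := (classicalLocation_le_iff (by linarith) (by linarith)).2 hab.le
        have hL2 : L ≤ 2 * C * logPlus b := by
          calc L ≤ 2 * logPlus ξb := logPlus_add_le_two_mul hξa0.le hξab
            _ ≤ 2 * (C * logPlus b) := by gcongr
            _ = 2 * C * logPlus b := by ring
        have hkey : b / logPlus b ≤ 4 * C * ((b - a) / L) := by
          have hq : (b - a) / (2 * C * logPlus b) ≤ (b - a) / L :=
            div_le_div_of_nonneg_left hba.le hL0 hL2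
          rw [div_le_iff₀ hlpb]
          calc b ≤ 2 * (b - a) := by linarith
            _ = 4 * C * ((b - a) / (2 * C * logPlus b)) * logPlus b := by field_simp; ring
            _ ≤ 4 * C * ((b - a) / L) * logPlus b := by gcongr
        calc ξb - ξa ≤ ξb := by linarith
          _ ≤ C * (b / logPlus b) := hbup
          _ ≤ C * (4 * C * ((b - a) / L)) := by gcongr
          _ = 4 * C ^ 2 * ((b - a) / L) := by ring
          _ ≤ CS * ((b - a) / L) := by gcongr; exact le_max_right _ _
  refine ⟨4 * π, CS, hπ, ?_, fun a b ha hb ↦ ?_⟩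
  · calc 4 * π = 4 * π * 1 := (mul_one _).symm
      _ ≤ 4 * π * M₁ := by gcongr; linarith
      _ ≤ CS := le_max_left _ _
  rcases lt_trichotomy a b with hab | heq | hba
  · obtain ⟨h1, h2⟩ := hmain a b ha hab
    have hpos : 0 < classicalLocation b - classicalLocation a :=
      sub_pos.2 (strictMonoOn_classicalLocation (by simp; linarith) (by simp; linarith) hab)
    rw [abs_of_pos hpos, abs_of_pos (sub_pos.2 hab)]
    exact ⟨h1, h2⟩
  · subst heq; simp
  · obtain ⟨h1, h2⟩ := hmain b a hb hba
    have hpos : 0 < classicalLocation a - classicalLocation b :=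
      sub_pos.2 (strictMonoOn_classicalLocation (by simp; linarith) (by simp; linarith) hba)
    rw [abs_sub_comm (classicalLocation b) (classicalLocation a), abs_of_pos hpos, abs_sub_comm b a,
      abs_of_pos (sub_pos.2 hba), add_comm (classicalLocation a) (classicalLocation b)]
    exact ⟨h1, h2⟩

/-- Opposite-sign part of Lemma 3.1 (ii), over real indices `a, b ≥ 1`:
`ξ_a + ξ_b ≍ (a + b)/log₊(ξ_a + ξ_b)` («if `j, k` have opposing sign, then (44) follows from
(43)»). [cite: RodgersTaoFMP2020, Lemma 3.1 (ii) = Lemma 8 (ii) eq. (44) p.21] -/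
theorem lemma31_ii_oppSign :
    ∃ c C : ℝ, 0 < c ∧ c ≤ C ∧ ∀ a b : ℝ, 1 ≤ a → 1 ≤ b →
      c * ((a + b) / logPlus (classicalLocation a + classicalLocation b)) ≤
          classicalLocation a + classicalLocation b ∧
        classicalLocation a + classicalLocation b ≤
          C * ((a + b) / logPlus (classicalLocation a + classicalLocation b)) := by
  obtain ⟨c, C, hc, hcC, hord⟩ := lemma31_i_order_holds
  have hC0 : 0 < C := hc.trans_le hcC
  -- one-sided statement for `a ≤ b`
  have hmain : ∀ a b : ℝ, 1 ≤ a → a ≤ b →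
      c ^ 2 / 2 * ((a + b) / logPlus (classicalLocation a + classicalLocation b)) ≤
          classicalLocation a + classicalLocation b ∧
        classicalLocation a + classicalLocation b ≤
          4 * C ^ 2 * ((a + b) / logPlus (classicalLocation a + classicalLocation b)) := by
    intro a b ha hab
    have hb : 1 ≤ b := by linarith
    set ξa := classicalLocation a with hξa
    set ξb := classicalLocation b with hξb
    set L := logPlus (ξa + ξb) with hL
    have hξa0 : 0 < ξa := classicalLocation_pos (by linarith)
    have hξb0 : 0 < ξb := classicalLocation_pos (by linarith)
    have hξab : ξa ≤ ξb := (classicalLocation_le_iff (by linarith) (by linarith)).2 hab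
    have hL0 : 0 < L := logPlus_pos _
    have hlpb := logPlus_pos b
    obtain ⟨hblo, hbup, hblog, hblog'⟩ := hord b hb
    have hL2 : L ≤ 2 * C * logPlus b := by
      calc L ≤ 2 * logPlus ξb := logPlus_add_le_two_mul hξa0.le hξab
        _ ≤ 2 * (C * logPlus b) := by gcongr
        _ = 2 * C * logPlus b := by ring
    have hLlo : c * logPlus b ≤ L := hblog.trans (logPlus_le_logPlus_add hξa0.le hξb0.le)
    constructor
    · -- `c²/2 (a+b)/L ≤ c²/2 · 2b/(c log₊ b) = c b/log₊ b ≤ ξ_b ≤ ξ_a + ξ_b`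
      have hkey : (a + b) / L ≤ 2 * b / (c * logPlus b) := by
        rw [div_le_div_iff₀ hL0 (by positivity)]
        calc (a + b) * (c * logPlus b) ≤ 2 * b * (c * logPlus b) := by gcongr; linarith
          _ ≤ 2 * b * L := by gcongr
      calc c ^ 2 / 2 * ((a + b) / L) ≤ c ^ 2 / 2 * (2 * b / (c * logPlus b)) := by gcongr
        _ = c * (b / logPlus b) := by field_simp
        _ ≤ ξb := hblo
        _ ≤ ξa + ξb := by linarith
    · have hkey : b / logPlus b ≤ 2 * C * ((a + b) / L) := by
        have hq : (a + b) / (2 * C * logPlus b) ≤ (a + b) / L :=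
          div_le_div_of_nonneg_left (by linarith) hL0 hL2
        rw [div_le_iff₀ hlpb]
        calc b ≤ a + b := by linarith
          _ = 2 * C * ((a + b) / (2 * C * logPlus b)) * logPlus b := by field_simp
          _ ≤ 2 * C * ((a + b) / L) * logPlus b := by gcongr
      calc ξa + ξb ≤ 2 * ξb := by linarith
        _ ≤ 2 * (C * (b / logPlus b)) := by gcongr
        _ ≤ 2 * (C * (2 * C * ((a + b) / L))) := by gcongr
        _ = 4 * C ^ 2 * ((a + b) / L) := by ring
  refine ⟨c ^ 2 / 2, 4 * C ^ 2, by positivity, ?_, fun a b ha hb ↦ ?_⟩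
  · nlinarith
  rcases le_or_gt a b with hab | hba
  · exact hmain a b ha hab
  · obtain ⟨h1, h2⟩ := hmain b a hb hba.le
    rw [add_comm (classicalLocation a), add_comm a]
    exact ⟨h1, h2⟩

/-- For `j > 0`: `ξ^{ℤ}_j = ξ_j`. [cite: RodgersTaoFMP2020, §3 eq. (42) p.21] -/
theorem classicalLocationInt_of_pos {j : ℤ} (hj : 0 < j) :
    classicalLocationInt j = classicalLocation (j : ℝ) := by
  rw [classicalLocationInt, Int.sign_eq_one_of_pos hj, Nat.cast_natAbs, Int.cast_abs,
    abs_of_pos (by exact_mod_cast hj : (0 : ℝ) < j)]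
  simp

/-- For `j < 0`: `ξ^{ℤ}_j = −ξ_{−j}`. [cite: RodgersTaoFMP2020, §3 eq. (42) p.21] -/
theorem classicalLocationInt_of_neg {j : ℤ} (hj : j < 0) :
    classicalLocationInt j = -classicalLocation (-(j : ℝ)) := by
  rw [classicalLocationInt, Int.sign_eq_neg_one_of_neg hj, Nat.cast_natAbs, Int.cast_abs,
    abs_of_neg (by exact_mod_cast hj : (j : ℝ) < 0)]
  simp

/-- **Lemma 3.1 (ii) holds** (eq. (44)): CONTENT discharge of `lemma31_ii` over
`ℤ* = {j : ℤ | j ≠ 0}` with the odd extension `ξ_{−j} = −ξ_j`: for `j, k` of the same sign the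
claim is `lemma31_ii_sameSign` at `(|j|, |k|)`, for opposite signs `|ξ_k − ξ_j| = ξ_{|j|} + ξ_{|k|}`,
`|k − j| = |j| + |k|` and the claim is `lemma31_ii_oppSign`.
[cite: RodgersTaoFMP2020, Lemma 3.1 (ii) = Lemma 8 (ii) eq. (44) p.21] -/
theorem lemma31_ii_holds : lemma31_ii := by
  obtain ⟨c₁, C₁, hc₁, hc₁C₁, hS⟩ := lemma31_ii_sameSign
  obtain ⟨c₂, C₂, hc₂, hc₂C₂, hO⟩ := lemma31_ii_oppSign
  refine ⟨min c₁ c₂, max C₁ C₂, lt_min hc₁ hc₂,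
    (min_le_left _ _).trans (hc₁C₁.trans (le_max_left _ _)), fun j k hj hk ↦ ?_⟩
  -- reduce a two-sided claim with constants `(c', C')`, `c ≤ c'`, `C' ≤ C`, to ours
  have widen : ∀ {X Q c' C' : ℝ}, 0 ≤ Q → min c₁ c₂ ≤ c' → C' ≤ max C₁ C₂ →
      (c' * Q ≤ X ∧ X ≤ C' * Q) → (min c₁ c₂ * Q ≤ X ∧ X ≤ max C₁ C₂ * Q) := by
    intro X Q c' C' hQ hc' hC' ⟨h1, h2⟩
    exact ⟨(mul_le_mul_of_nonneg_right hc' hQ).trans h1, h2.trans (mul_le_mul_of_nonneg_right hC' hQ)⟩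
  rcases lt_or_gt_of_ne hj with hjneg | hjpos <;> rcases lt_or_gt_of_ne hk with hkneg | hkpos
  · -- `j < 0`, `k < 0`: same sign, indices `−j`, `−k`
    have ha : (1 : ℝ) ≤ -(j : ℝ) := by exact_mod_cast (show 1 ≤ -j by omega)
    have hb : (1 : ℝ) ≤ -(k : ℝ) := by exact_mod_cast (show 1 ≤ -k by omega)
    have hξa := classicalLocation_pos (by linarith : (-1:ℝ) ≤ -(j:ℝ))
    have hξb := classicalLocation_pos (by linarith : (-1:ℝ) ≤ -(k:ℝ))
    rw [classicalLocationInt_of_neg hjneg, classicalLocationInt_of_neg hkneg, abs_neg, abs_neg,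
      abs_of_pos hξa, abs_of_pos hξb,
      show -classicalLocation (-(k:ℝ)) - -classicalLocation (-(j:ℝ)) =
        -(classicalLocation (-(k:ℝ)) - classicalLocation (-(j:ℝ))) by ring, abs_neg,
      show ((k:ℝ) - j) = -((-(k:ℝ)) - (-(j:ℝ))) by ring, abs_neg]
    exact widen (div_nonneg (abs_nonneg _) (logPlus_pos _).le) (min_le_left _ _) (le_max_left _ _)
      (hS _ _ ha hb)
  · -- `j < 0 < k`: opposite signs, indices `−j`, `k`
    have ha : (1 : ℝ) ≤ -(j : ℝ) := by exact_mod_cast (show 1 ≤ -j by omega)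
    have hb : (1 : ℝ) ≤ (k : ℝ) := by exact_mod_cast (show 1 ≤ k by omega)
    have hξa := classicalLocation_pos (by linarith : (-1:ℝ) ≤ -(j:ℝ))
    have hξb := classicalLocation_pos (by linarith : (-1:ℝ) ≤ (k:ℝ))
    rw [classicalLocationInt_of_neg hjneg, classicalLocationInt_of_pos hkpos, abs_neg,
      abs_of_pos hξa, abs_of_pos hξb,
      show ((k:ℝ) - j) = (-(j:ℝ)) + k by ring,
      abs_of_pos (show (0:ℝ) < -(j:ℝ) + k by linarith),
      show classicalLocation (k:ℝ) - -classicalLocation (-(j:ℝ)) =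
        classicalLocation (-(j:ℝ)) + classicalLocation (k:ℝ) by ring,
      abs_of_pos (show 0 < classicalLocation (-(j:ℝ)) + classicalLocation (k:ℝ) by linarith)]
    exact widen (div_nonneg (by linarith) (logPlus_pos _).le) (min_le_right _ _) (le_max_right _ _)
      (hO _ _ ha hb)
  · -- `k < 0 < j`: opposite signs, indices `j`, `−k`
    have ha : (1 : ℝ) ≤ (j : ℝ) := by exact_mod_cast (show 1 ≤ j by omega)
    have hb : (1 : ℝ) ≤ -(k : ℝ) := by exact_mod_cast (show 1 ≤ -k by omega)
    have hξa := classicalLocation_pos (by linarith : (-1:ℝ) ≤ (j:ℝ))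
    have hξb := classicalLocation_pos (by linarith : (-1:ℝ) ≤ -(k:ℝ))
    rw [classicalLocationInt_of_pos hjpos, classicalLocationInt_of_neg hkneg, abs_neg,
      abs_of_pos hξa, abs_of_pos hξb,
      show ((k:ℝ) - j) = -((j:ℝ) + (-(k:ℝ))) by ring, abs_neg,
      abs_of_pos (show (0:ℝ) < (j:ℝ) + -(k:ℝ) by linarith),
      show -classicalLocation (-(k:ℝ)) - classicalLocation (j:ℝ) =
        -(classicalLocation (j:ℝ) + classicalLocation (-(k:ℝ))) by ring, abs_neg,
      abs_of_pos (show 0 < classicalLocation (j:ℝ) + classicalLocation (-(k:ℝ)) by linarith)]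
    exact widen (div_nonneg (by linarith) (logPlus_pos _).le) (min_le_right _ _) (le_max_right _ _)
      (hO _ _ ha hb)
  · -- `0 < j`, `0 < k`: same sign
    have ha : (1 : ℝ) ≤ (j : ℝ) := by exact_mod_cast (show 1 ≤ j by omega)
    have hb : (1 : ℝ) ≤ (k : ℝ) := by exact_mod_cast (show 1 ≤ k by omega)
    have hξa := classicalLocation_pos (by linarith : (-1:ℝ) ≤ (j:ℝ))
    have hξb := classicalLocation_pos (by linarith : (-1:ℝ) ≤ (k:ℝ))
    rw [classicalLocationInt_of_pos hjpos, classicalLocationInt_of_pos hkpos,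
      abs_of_pos hξa, abs_of_pos hξb]
    exact widen (div_nonneg (abs_nonneg _) (logPlus_pos _).le) (min_le_left _ _) (le_max_left _ _)
      (hS _ _ ha hb)

/-! ## The as-printed form of (45) is false

With the printed main term `4π(k−j)/log ξ_j` (instead of `4π(k−j)/log(ξ_j/4π)`), already
`k = j + 1` violates the claimed error `O(1/(j log² ξ_j))`: the true gap is `4π/log(θ/4π)` for some
`θ ∈ (ξ_j, ξ_{j+1})`, which exceeds `4π/log ξ_j` by at least `π/log² ξ_j` (as `log 4π > 2`), and
`π/log² ξ_j ≤ A/(j log² ξ_j)` fails for `j > A/π`. The statement below is the verbatim rendering of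
(45) as printed (same quantifier scheme as `lemma31_iii`), negated; it is recorded as the formal
ERRATUM, not as a fact. -/

/-- `2 < log 4π` (`e² < 7.4 < 12 < 4π`). [cite: RodgersTaoFMP2020, §3 p.20 (footnote to (38))] -/
theorem two_lt_log_four_pi : 2 < Real.log (4 * π) := by
  have h12 : (12 : ℝ) < 4 * π := by nlinarith [Real.pi_gt_three]
  have hexp : Real.exp 2 < 12 := by
    have hup : Real.exp 1 < 2.7182818286 := Real.exp_one_lt_d9
    have h2 : Real.exp 2 = Real.exp 1 ^ 2 := by rw [← Real.exp_nat_mul]; norm_num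
    have hpow : Real.exp 1 ^ 2 < (2.7182818286 : ℝ) ^ 2 :=
      pow_lt_pow_left₀ hup (Real.exp_pos 1).le (by norm_num)
    rw [h2]; linarith [show (2.7182818286 : ℝ) ^ 2 < 12 by norm_num]
  calc (2 : ℝ) = Real.log (Real.exp 2) := (Real.log_exp 2).symm
    _ < Real.log (4 * π) := Real.log_lt_log (Real.exp_pos 2) (hexp.trans h12)

/-- **ERRATUM to Rodgers–Tao 2020, eq. (45) = Lemma 3.1 (iii) as printed**: the approximation
`ξ_k − ξ_j = 4π(k−j)/log ξ_j + O_K(|k−j|²/(j log² ξ_j))` for `1 ≤ j ≍ k` is FALSE (the source's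
mean-value argument yields the main term `4π(k−j)/log(ξ_j/4π)`, see `lemma31_iii_holds`; the
printed `log ξ_j` drops the `4π` of (39)). Refutation with `K = 2`, `k = j + 1`, `j = |A|/π + 1`.
[cite: RodgersTaoFMP2020, Lemma 3.1 (iii) = Lemma 8 (iii) eq. (45) p.21 (as printed; refuted)] -/
theorem not_eq45_asPrinted :
    ¬ (∀ K : ℝ, 1 ≤ K → ∃ A : ℝ, ∀ j k : ℝ, 1 ≤ j → 1 ≤ k → j ≤ K * k → k ≤ K * j →
      |classicalLocation k - classicalLocation j -
          4 * π * (k - j) / Real.log (classicalLocation j)| ≤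
        A * ((k - j) ^ 2 / (j * Real.log (classicalLocation j) ^ 2))) := by
  intro h
  obtain ⟨A, hA⟩ := h 2 (by norm_num)
  have hπ0 : 0 < π := Real.pi_pos
  have hπ : 0 < 4 * π := by positivity
  set j : ℝ := |A| / π + 1 with hjdef
  have hj1 : 1 ≤ j := by have := div_nonneg (abs_nonneg A) hπ0.le; linarith
  have hjA : A < π * j := by
    have : π * j = |A| + π := by rw [hjdef]; field_simp
    rw [this]; linarith [le_abs_self A]
  have hbound := hA j (j + 1) hj1 (by linarith) (by linarith) (by linarith)
  obtain ⟨θ, hθ1, hθ2, hℓθ, hgap⟩ :=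
    exists_mvt_classicalLocation (y := j) (y' := j + 1) (by linarith) (by linarith)
  set ξj := classicalLocation j with hξj
  set ξk := classicalLocation (j + 1) with hξk
  set ℓθ := Real.log (θ / (4 * π)) with hℓθdef
  set ℓj := Real.log (ξj / (4 * π)) with hℓjdef
  set Lj := Real.log ξj with hLj
  set Lk := Real.log ξk with hLk
  have hξj4 : 4 * π ≤ ξj := four_pi_le_classicalLocation (by linarith)
  have hξj0 : 0 < ξj := by linarith
  have hξj1 : 1 < ξj := one_lt_classicalLocation hj1
  have hθ0 : 0 < θ := hξj0.trans hθ1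
  have hξk0 : 0 < ξk := hθ0.trans hθ2
  have hℓj1 : 1 < ℓj := one_lt_log_classicalLocation_div hj1
  have hLj0 : 0 < Lj := Real.log_pos hξj1
  have hLjk : Lj ≤ Lk := Real.log_le_log hξj0 (by linarith)
  have hLk0 : 0 < Lk := by linarith
  -- the gap `ξ_{j+1} − ξ_j = 4π/ℓ_θ ≤ 4π/ℓ_j ≤ 4π ≤ ξ_j`
  have hgap1 : ξk - ξj = 4 * π / ℓθ := by rw [hgap]; ring
  have hℓjθ : ℓj ≤ ℓθ := Real.log_le_log (div_pos hξj0 hπ) (by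
    rw [div_le_div_iff_of_pos_right hπ]; exact hθ1.le)
  have hgap_le : ξk - ξj ≤ ξj := by
    rw [hgap1]
    calc 4 * π / ℓθ ≤ 4 * π / 1 := div_le_div_of_nonneg_left hπ.le one_pos (by linarith)
      _ ≤ ξj := by rw [div_one]; exact hξj4
  -- hence `L_k ≤ 2 L_j`
  have hLk2 : Lk ≤ 2 * Lj := by
    have hsq : ξk ≤ ξj ^ 2 := by
      nlinarith [mul_le_mul_of_nonneg_right hξj4 hξj0.le, Real.pi_gt_three]
    rw [hLk, hLj, ← Real.log_rpow hξj0, Real.rpow_two]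
    exact Real.log_le_log hξk0 hsq
  -- `ℓ_θ ≤ L_k` and `L_j − ℓ_θ ≥ log 4π − (ξ_k − ξ_j)/ξ_j ≥ 1`
  have hℓθLk : ℓθ ≤ Lk := by
    rw [hℓθdef, hLk]
    exact Real.log_le_log (div_pos hθ0 hπ) ((div_le_self hθ0.le one_le_four_pi).trans hθ2.le)
  have hnum : 1 ≤ Lj - ℓθ := by
    have h1 : Lj - ℓθ = Real.log (4 * π) - Real.log (θ / ξj) := by
      rw [hLj, hℓθdef, Real.log_div hθ0.ne' hπ.ne', Real.log_div hθ0.ne' hξj0.ne']; ring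
    have h2 : Real.log (θ / ξj) ≤ 1 := by
      calc Real.log (θ / ξj) ≤ θ / ξj - 1 := Real.log_le_sub_one_of_pos (div_pos hθ0 hξj0)
        _ ≤ 1 := by rw [div_sub_one hξj0.ne', div_le_one hξj0]; linarith
    have h3 := two_lt_log_four_pi
    linarith
  -- the deviation from the printed main term is at least `π/L_j²`
  have hD : ξk - ξj - 4 * π * (j + 1 - j) / Lj = 4 * π * ((Lj - ℓθ) / (ℓθ * Lj)) := by
    rw [hgap1]; field_simp; ring
  have hDlow : π / Lj ^ 2 ≤ ξk - ξj - 4 * π * (j + 1 - j) / Lj := by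
    rw [hD]
    calc π / Lj ^ 2 = 4 * π * (1 / (2 * Lj * (2 * Lj))) := by field_simp; ring
      _ ≤ 4 * π * (1 / (Lk * Lk)) := by gcongr
      _ ≤ 4 * π * ((Lj - ℓθ) / (ℓθ * Lj)) := by
          gcongr 4 * π * ?_
          calc 1 / (Lk * Lk) ≤ 1 / (ℓθ * Lj) := by gcongr
            _ ≤ (Lj - ℓθ) / (ℓθ * Lj) := by gcongr
  -- … while the printed claim bounds it by `A/(j L_j²)`
  have hup : ξk - ξj - 4 * π * (j + 1 - j) / Lj ≤ A * (1 / (j * Lj ^ 2)) := by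
    have := (le_abs_self _).trans hbound
    simpa using this
  have hcontra : π / Lj ^ 2 ≤ A * (1 / (j * Lj ^ 2)) := hDlow.trans hup
  rw [div_le_iff₀ (by positivity)] at hcontra
  have : A * (1 / (j * Lj ^ 2)) * Lj ^ 2 = A / j := by field_simp
  rw [this, le_div_iff₀ (by linarith)] at hcontra
  linarith

/-! ## Display (37), RH-FREE upper half: `N_0([0,T]) ≤ Ψ(T) + O(log₊ T)` unconditionally

The printed (37) `N_0([0,T]) = Ψ(T) + O(log₊ T)` (classical Riemann–von Mangoldt «combined with
(3)») is typed as the named fact `eq37` under the source's standing hypothesis `Λ < 0`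
(VACUOUS-AS-PRINTED). Its RH-FREE content is the UPPER bound: the real zeros of `H_0` in `[0, T]`
are the doubled ordinates of the zeros of `ζ` ON the critical line up to height `T/2`
(`setOf_deBruijnH_zero_eq_image`, from `H_0 = ξ(½ + iz/2)/8`), these are among all zeros with
`0 < Im ρ ≤ T/2` counted with multiplicity, and `N(T/2) = Ψ(T) + O(log T)` is the tree theorem
`riemann_von_mangoldt_holds`. (The lower bound is equivalent to «all zeros up to height `T/2` are
on the line and simple up to `O(log T)`», i.e. RH-strength; not claimed.) -/

section Eq37Upper

open Complex Filter Asymptotics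

/-- The number of DISTINCT ordinates `γ ∈ (0, T]` of zeros of `ζ` on the critical line is at most
`N(T)` (all zeros with `0 < Im ρ ≤ T`, counted with multiplicity) — unconditionally.
[cite: Titchmarsh1986, §9.1] -/
theorem ncard_criticalOrdinates_le_zetaZeroCount (T : ℝ) :
    {γ : ℝ | γ ∈ Set.Ioc (0 : ℝ) T ∧ riemannZeta (1 / 2 + (γ : ℂ) * Complex.I) = 0}.ncard ≤
      zetaZeroCount T := by
  set S : Set ℝ := {γ : ℝ | γ ∈ Set.Ioc (0 : ℝ) T ∧ riemannZeta (1 / 2 + (γ : ℂ) * Complex.I) = 0}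
    with hS
  have hB : (zetaZeroBox 0 T).Finite := zetaZeroBox_finite 0 T
  have himg : (fun γ : ℝ ↦ (1 / 2 + γ * I : ℂ)) '' S ⊆ zetaZeroBox 0 T := by
    rintro ρ ⟨γ, ⟨⟨h0, hT⟩, hz⟩, rfl⟩
    refine ⟨hz, ?_, ?_, ?_, ?_⟩
    · simp
    · norm_num
    · simpa using h0
    · simpa using hT
  have hIfin : ((fun γ : ℝ ↦ (1 / 2 + γ * I : ℂ)) '' S).Finite := hB.subset himg
  have hinj : Function.Injective fun γ : ℝ ↦ (1 / 2 + γ * I : ℂ) := injective_half_add_mul_I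
  rw [← Set.ncard_image_of_injective S hinj]
  -- `#(f '' S) ≤ Σ_{ρ ∈ box} m(ρ)` since `m ≥ 1` on the box
  unfold zetaZeroCount zetaZeroCountRe
  have hsum_ge : (((fun γ : ℝ ↦ (1 / 2 + γ * I : ℂ)) '' S).ncard : ℤ) ≤ ∑ᶠ ρ ∈ zetaZeroBox 0 T, riemannZetaZeroOrder ρ := by
    rw [finsum_mem_eq_finite_toFinset_sum _ hB, Set.ncard_eq_toFinset_card _ hIfin]
    have hsub : hIfin.toFinset ⊆ hB.toFinset := (Set.Finite.toFinset_subset_toFinset).2 himg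
    calc ((hIfin.toFinset.card : ℕ) : ℤ) = ∑ ρ ∈ hIfin.toFinset, (1 : ℤ) := by simp
      _ ≤ ∑ ρ ∈ hIfin.toFinset, riemannZetaZeroOrder ρ := by
          refine Finset.sum_le_sum fun ρ hρ ↦ ?_
          have hρB : ρ ∈ zetaZeroBox 0 T := himg ((Set.Finite.mem_toFinset hIfin).1 hρ)
          obtain ⟨hz, -, -, him, -⟩ := hρB
          have hρ1 : ρ ≠ 1 := by rintro rfl; simp at him
          have := (riemannZetaZeroOrder_pos_iff hρ1).2 hz
          omega
      _ ≤ ∑ ρ ∈ hB.toFinset, riemannZetaZeroOrder ρ :=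
          Finset.sum_le_sum_of_subset_of_nonneg hsub fun ρ hρ _ ↦
            riemannZetaZeroOrder_nonneg_of_mem_zetaZeroBox ((Set.Finite.mem_toFinset hB).1 hρ)
  exact (Int.le_toNat (le_trans (by positivity) hsum_ge)).2 hsum_ge

/-- **RH-FREE half of display (37)**: unconditionally, the number of real zeros of `H_0` in `[0, X]`
is at most `N(X/2)`: the real zeros of `H_0` in `[0, X]` are exactly the numbers `2γ` with
`γ ∈ (0, X/2]` the ordinate of a zero of `ζ` ON the critical line (`setOf_deBruijnH_zero_eq_image`,
from `H_0 = ξ(½ + iz/2)/8`), and distinct critical zeros are among all zeros counted with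
multiplicity. (Equality is the standing hypothesis `Λ < 0` of the source, cf.
`deBruijnZeroCount_zero_Icc`.) [cite: RodgersTaoFMP2020, §3 eq. (37) p.20] -/
theorem deBruijnZeroCount_zero_Icc_le_zetaZeroCount (X : ℝ) :
    deBruijnZeroCount 0 (Icc 0 X) ≤ zetaZeroCount (X / 2) := by
  rw [deBruijnZeroCount_eq, setOf_deBruijnH_zero_eq_image,
    Set.ncard_image_of_injective _ (mul_right_injective₀ (two_ne_zero (α := ℝ)))]
  exact ncard_criticalOrdinates_le_zetaZeroCount (X / 2)

/-- `Ψ(T) ≥ −1` for `T ≥ 0` (`u log u − u ≥ −1` for `u > 0`, with equality at `u = 1`, i.e.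
`T = 4π`; `Ψ(0) = 0`). [cite: RodgersTaoFMP2020, §3 eq. (38) p.20] -/
theorem neg_one_le_rodgersTaoPsi {T : ℝ} (hT : 0 ≤ T) : -1 ≤ rodgersTaoPsi T := by
  have hπ : 0 < 4 * π := by positivity
  rcases hT.eq_or_lt with rfl | hT0
  · simp [rodgersTaoPsi]
  · set u : ℝ := T / (4 * π) with hu
    have hu0 : 0 < u := div_pos hT0 hπ
    have hlog : 1 - u⁻¹ ≤ Real.log u := Real.one_sub_inv_le_log_of_pos hu0
    rw [rodgersTaoPsi, ← hu]
    have h1 : u * (1 - u⁻¹) = u - 1 := by field_simp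
    nlinarith [mul_le_mul_of_nonneg_left hlog hu0.le]

/-- The Riemann–von Mangoldt main term at height `T/2` is `Ψ(T)`:
`(T′/2π) log(T′/2π) − T′/2π = Ψ(T)` for `T′ = T/2` (the `z = 2γ` normalisation of (3)).
[cite: RodgersTaoFMP2020, §3 eq. (37)–(38) p.20] -/
theorem rvmMain_half_eq_rodgersTaoPsi (T : ℝ) :
    (T / 2) / (2 * π) * Real.log ((T / 2) / (2 * π)) - (T / 2) / (2 * π) = rodgersTaoPsi T := by
  have : (T / 2) / (2 * π) = T / (4 * π) := by ring
  rw [rodgersTaoPsi, this]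

/-- **RH-FREE CONTENT of display (37), upper half**: there is an absolute `A` with
`N_0([0, T]) ≤ Ψ(T) + A log₊ T` for all `T ≥ 0`, unconditionally — from the Riemann–von Mangoldt
formula (tree theorem `riemann_von_mangoldt_holds`) and `N_0([0,T]) ≤ N(T/2)`
(`deBruijnZeroCount_zero_Icc_le_zetaZeroCount`). The printed two-sided (37) is the named fact
`eq37` (VACUOUS-AS-PRINTED under the standing hypothesis `Λ < 0`); this is its half that holds
without any hypothesis. [cite: RodgersTaoFMP2020, §3 eq. (37) p.20] -/
theorem eq37_upper : ∃ A : ℝ, ∀ T : ℝ, 0 ≤ T →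
    (deBruijnZeroCount 0 (Icc 0 T) : ℝ) ≤ rodgersTaoPsi T + A * logPlus T := by
  obtain ⟨C, hC⟩ := riemann_von_mangoldt_holds.bound
  obtain ⟨T₁, hT₁⟩ := eventually_atTop.1 hC
  set T₀ : ℝ := max T₁ 2 with hT₀
  have hT₀2 : 2 ≤ T₀ := le_max_right _ _
  set B : ℝ := (zetaZeroCount T₀ : ℝ) with hB
  have hlog2 : 0 < Real.log 2 := Real.log_pos (by norm_num)
  refine ⟨max (max C 0) ((B + 1) / Real.log 2), fun T hT ↦ ?_⟩
  have hlp : 0 < logPlus T := logPlus_pos T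
  have hlp2 : Real.log 2 ≤ logPlus T := log_two_le_logPlus T
  have hN : (deBruijnZeroCount 0 (Icc 0 T) : ℝ) ≤ zetaZeroCount (T / 2) := by
    exact_mod_cast deBruijnZeroCount_zero_Icc_le_zetaZeroCount T
  rcases le_or_gt T₀ (T / 2) with hfar | hnear
  · -- `T/2 ≥ T₀ ≥ T₁`: Riemann–von Mangoldt at `T/2`
    have h := hT₁ (T / 2) ((le_max_left _ _).trans hfar)
    rw [Real.norm_eq_abs, Real.norm_eq_abs] at h
    have hT2 : 2 ≤ T / 2 := hT₀2.trans hfar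
    have hlogT : 0 < Real.log (T / 2) := Real.log_pos (by linarith)
    rw [abs_of_pos hlogT] at h
    have hmain := rvmMain_half_eq_rodgersTaoPsi T
    have h1 : (zetaZeroCount (T / 2) : ℝ) ≤ rodgersTaoPsi T + C * Real.log (T / 2) := by
      have := (abs_le.1 h).2
      linarith
    have hlogle : Real.log (T / 2) ≤ logPlus T := by
      rw [logPlus_of_nonneg hT]
      exact Real.log_le_log (by linarith) (by linarith)
    have hC0 : C * Real.log (T / 2) ≤ max (max C 0) ((B + 1) / Real.log 2) * logPlus T := by
      calc C * Real.log (T / 2) ≤ max C 0 * Real.log (T / 2) :=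
            mul_le_mul_of_nonneg_right (le_max_left _ _) hlogT.le
        _ ≤ max C 0 * logPlus T := mul_le_mul_of_nonneg_left hlogle (le_max_right _ _)
        _ ≤ max (max C 0) ((B + 1) / Real.log 2) * logPlus T :=
            mul_le_mul_of_nonneg_right (le_max_left _ _) hlp.le
    linarith
  · -- `T/2 < T₀`: bounded range, `N_0 ≤ N(T₀) = B`, `Ψ ≥ −1`
    have hmono : (zetaZeroCount (T / 2) : ℝ) ≤ B := by
      rw [hB]; exact_mod_cast zetaZeroCount_mono hnear.le
    have hΨ := neg_one_le_rodgersTaoPsi hT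
    have hA : (B + 1) ≤ max (max C 0) ((B + 1) / Real.log 2) * logPlus T := by
      have hB0 : 0 ≤ B + 1 := by positivity
      calc B + 1 = (B + 1) / Real.log 2 * Real.log 2 := by field_simp
        _ ≤ (B + 1) / Real.log 2 * logPlus T :=
            mul_le_mul_of_nonneg_left hlp2 (div_nonneg hB0 hlog2.le)
        _ ≤ max (max C 0) ((B + 1) / Real.log 2) * logPlus T :=
            mul_le_mul_of_nonneg_right (le_max_right _ _) hlp.le
    linarith

end Eq37Upper

/-! ## R1c bridges: the §1.2 notation carriers of `RodgersTaoRiemannVonMangoldt.lean` are the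
## tree's names of record

The statements file `RodgersTaoRiemannVonMangoldt.lean` (v1, p420624) declared its own carriers of
`log₊`, of `ξ_j` on `ℤ*` and of `x_j(t)` on `ℤ*` in the paper sub-namespace `RodgersTao2020`; the
names of record (first landed; rt-lead rulings R1/R1b/R1c, rh-crit/rt/STATUS.md 03:47–05:05Z) are
`Literature.NumberTheory.LFunctions.logPlus` and `…classicalLocationZ` (`RodgersTaoNotation.lean`,
p420526) and `…deBruijnZeroZ` (`RodgersTaoZeroDynamics.lean`, p420264). The bodies are literally
the same, so each pair is equal by `rfl`; these bridges let any user of the §3 facts rewrite them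
over the names of record (R1c AMENDED 05:05:38Z: «ONE bridge theorem per name … is FULL
COMPLIANCE»). -/

/-- R1c bridge; name of record = `Literature.NumberTheory.LFunctions.logPlus`
(`RodgersTaoNotation.lean`): the §3 file's `RodgersTao2020.logPlus` IS that function
(`log₊ x = log(2 + |x|)`, §1.2). [cite: RodgersTaoFMP2020, §1.2 p.7] -/
theorem logPlus_eq_logPlus :
    _root_.Literature.NumberTheory.LFunctions.RodgersTao2020.logPlus =
      _root_.Literature.NumberTheory.LFunctions.logPlus := rfl

/-- R1c bridge; name of record = `Literature.NumberTheory.LFunctions.classicalLocationZ`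
(`RodgersTaoNotation.lean`): the §3 file's `RodgersTao2020.classicalLocationInt` IS that function
(`ξ_j = sign(j)·ξ_{|j|}` on `ℤ*`, §3 after (42)). [cite: RodgersTaoFMP2020, §3 eq. (42) p.21] -/
theorem classicalLocationInt_eq_classicalLocationZ :
    _root_.Literature.NumberTheory.LFunctions.RodgersTao2020.classicalLocationInt =
      _root_.Literature.NumberTheory.LFunctions.classicalLocationZ := rfl

/-- R1c bridge; name of record = `Literature.NumberTheory.LFunctions.deBruijnZeroZ`
(`RodgersTaoZeroDynamics.lean`): the §3 file's `RodgersTao2020.deBruijnZeroInt` IS that function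
(`x_j(t) = sign(j)·x_{|j|}(t)` on `ℤ*`, §1.2). [cite: RodgersTaoFMP2020, §1.2 p.7] -/
theorem deBruijnZeroInt_eq_deBruijnZeroZ :
    _root_.Literature.NumberTheory.LFunctions.RodgersTao2020.deBruijnZeroInt =
      _root_.Literature.NumberTheory.LFunctions.deBruijnZeroZ := rfl

/-- Lemma 3.1 (ii) restated over the carriers of record (`logPlus`, `classicalLocationZ`), via the
R1c bridges (definitionally the statement of `lemma31_ii`).
[cite: RodgersTaoFMP2020, Lemma 3.1 (ii) = Lemma 8 (ii) eq. (44) p.21] -/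
theorem lemma31_ii_holds_record :
    ∃ c C : ℝ, 0 < c ∧ c ≤ C ∧ ∀ j k : ℤ, j ≠ 0 → k ≠ 0 →
      c * (|(k : ℝ) - j| / _root_.Literature.NumberTheory.LFunctions.logPlus
          (|classicalLocationZ j| + |classicalLocationZ k|)) ≤
          |classicalLocationZ k - classicalLocationZ j| ∧
        |classicalLocationZ k - classicalLocationZ j| ≤
          C * (|(k : ℝ) - j| / _root_.Literature.NumberTheory.LFunctions.logPlus
            (|classicalLocationZ j| + |classicalLocationZ k|)) :=
  lemma31_ii_holds

/-! ## ERRATUM E7 over integer indices (referee ask, rt/STATUS 05:55Z): the as-printed (45) on `ℤ*` -/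

/-- The core of ERRATUM E7, as an explicit inequality: for every real `j ≥ 1` the consecutive gap
of the classical locations exceeds the AS-PRINTED main term of (45) by at least `π/log² ξ_j`:
`π/log² ξ_j ≤ (ξ_{j+1} − ξ_j) − 4π/log ξ_j` (mean value theorem: the gap is `4π/log(θ/4π)`,
`θ ∈ (ξ_j, ξ_{j+1})`, and `log ξ_j − log(θ/4π) ≥ log 4π − 1 > 1`, `log ξ_{j+1} ≤ 2 log ξ_j`).
[cite: RodgersTaoFMP2020, Lemma 3.1 (iii) = Lemma 8 (iii) eq. (45) p.21 (as printed; refuted)] -/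
theorem eq45_asPrinted_gap_lower {j : ℝ} (hj1 : 1 ≤ j) :
    π / Real.log (classicalLocation j) ^ 2 ≤
      classicalLocation (j + 1) - classicalLocation j - 4 * π / Real.log (classicalLocation j) := by
  have hπ0 : 0 < π := Real.pi_pos
  have hπ : 0 < 4 * π := by positivity
  obtain ⟨θ, hθ1, hθ2, hℓθ, hgap⟩ :=
    exists_mvt_classicalLocation (y := j) (y' := j + 1) (by linarith) (by linarith)
  set ξj := classicalLocation j with hξj
  set ξk := classicalLocation (j + 1) with hξk
  set ℓθ := Real.log (θ / (4 * π)) with hℓθdef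
  set ℓj := Real.log (ξj / (4 * π)) with hℓjdef
  set Lj := Real.log ξj with hLj
  set Lk := Real.log ξk with hLk
  have hξj4 : 4 * π ≤ ξj := four_pi_le_classicalLocation (by linarith)
  have hξj0 : 0 < ξj := by linarith
  have hξj1 : 1 < ξj := one_lt_classicalLocation hj1
  have hθ0 : 0 < θ := hξj0.trans hθ1
  have hξk0 : 0 < ξk := hθ0.trans hθ2
  have hℓj1 : 1 < ℓj := one_lt_log_classicalLocation_div hj1
  have hLj0 : 0 < Lj := Real.log_pos hξj1
  have hLjk : Lj ≤ Lk := Real.log_le_log hξj0 (by linarith)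
  have hLk0 : 0 < Lk := by linarith
  have hgap1 : ξk - ξj = 4 * π / ℓθ := by rw [hgap]; ring
  have hℓjθ : ℓj ≤ ℓθ := Real.log_le_log (div_pos hξj0 hπ) (by
    rw [div_le_div_iff_of_pos_right hπ]; exact hθ1.le)
  have hgap_le : ξk - ξj ≤ ξj := by
    rw [hgap1]
    calc 4 * π / ℓθ ≤ 4 * π / 1 := div_le_div_of_nonneg_left hπ.le one_pos (by linarith)
      _ ≤ ξj := by rw [div_one]; exact hξj4
  have hLk2 : Lk ≤ 2 * Lj := by
    have hsq : ξk ≤ ξj ^ 2 := by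
      nlinarith [mul_le_mul_of_nonneg_right hξj4 hξj0.le, Real.pi_gt_three]
    rw [hLk, hLj, ← Real.log_rpow hξj0, Real.rpow_two]
    exact Real.log_le_log hξk0 hsq
  have hℓθLk : ℓθ ≤ Lk := by
    rw [hℓθdef, hLk]
    exact Real.log_le_log (div_pos hθ0 hπ) ((div_le_self hθ0.le one_le_four_pi).trans hθ2.le)
  have hnum : 1 ≤ Lj - ℓθ := by
    have h1 : Lj - ℓθ = Real.log (4 * π) - Real.log (θ / ξj) := by
      rw [hLj, hℓθdef, Real.log_div hθ0.ne' hπ.ne', Real.log_div hθ0.ne' hξj0.ne']; ring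
    have h2 : Real.log (θ / ξj) ≤ 1 := by
      calc Real.log (θ / ξj) ≤ θ / ξj - 1 := Real.log_le_sub_one_of_pos (div_pos hθ0 hξj0)
        _ ≤ 1 := by rw [div_sub_one hξj0.ne', div_le_one hξj0]; linarith
    have h3 := two_lt_log_four_pi
    linarith
  have hD : ξk - ξj - 4 * π / Lj = 4 * π * ((Lj - ℓθ) / (ℓθ * Lj)) := by
    rw [hgap1]; field_simp
  rw [hD]
  calc π / Lj ^ 2 = 4 * π * (1 / (2 * Lj * (2 * Lj))) := by field_simp; ring
    _ ≤ 4 * π * (1 / (Lk * Lk)) := by gcongr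
    _ ≤ 4 * π * ((Lj - ℓθ) / (ℓθ * Lj)) := by
        gcongr 4 * π * ?_
        calc 1 / (Lk * Lk) ≤ 1 / (ℓθ * Lj) := by gcongr
          _ ≤ (Lj - ℓθ) / (ℓθ * Lj) := by gcongr

/-- **ERRATUM E7, integer-indexed (as printed over `ℤ*`) form** (referee ask, rt/STATUS 05:55Z):
the AS-PRINTED (45) «for `1 ≤ j ≍ k`, `ξ_k − ξ_j = 4π(k−j)/log ξ_j + O(|k−j|²/(j log² ξ_j))`»,
quantified over INTEGER indices `j, k ≥ 1`, is false (witness `K = 2`, `j = ⌈|A|/π⌉ + 1`,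
`k = j + 1`, by `eq45_asPrinted_gap_lower`). Companion of the real-indexed `not_eq45_asPrinted`.
[cite: RodgersTaoFMP2020, Lemma 3.1 (iii) = Lemma 8 (iii) eq. (45) p.21 (as printed; refuted)] -/
theorem not_eq45_asPrinted_int :
    ¬ (∀ K : ℝ, 1 ≤ K → ∃ A : ℝ, ∀ j k : ℤ, 1 ≤ j → 1 ≤ k → (j : ℝ) ≤ K * k → (k : ℝ) ≤ K * j →
      |classicalLocation (k : ℝ) - classicalLocation (j : ℝ) -
          4 * π * ((k : ℝ) - j) / Real.log (classicalLocation (j : ℝ))| ≤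
        A * (((k : ℝ) - j) ^ 2 / (j * Real.log (classicalLocation (j : ℝ)) ^ 2))) := by
  intro h
  obtain ⟨A, hA⟩ := h 2 (by norm_num)
  have hπ0 : 0 < π := Real.pi_pos
  set n : ℕ := ⌈|A| / π⌉₊ + 1 with hn
  have hcast : (n : ℝ) = (⌈|A| / π⌉₊ : ℝ) + 1 := by simp [hn]
  have hn1 : (1 : ℝ) ≤ n := by
    rw [hcast]; linarith [Nat.cast_nonneg (α := ℝ) ⌈|A| / π⌉₊]
  have hnA : A < π * n := by
    have hceil : |A| / π ≤ (⌈|A| / π⌉₊ : ℝ) := Nat.le_ceil _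
    have : |A| ≤ π * (⌈|A| / π⌉₊ : ℝ) := by
      rw [div_le_iff₀ hπ0] at hceil; linarith
    rw [hcast]; linarith [le_abs_self A]
  have hb := hA (n : ℤ) ((n : ℤ) + 1) (by exact_mod_cast (show 1 ≤ n by omega))
    (by omega) (by push_cast; linarith) (by push_cast; linarith)
  push_cast at hb
  have hsimp : ((n : ℝ) + 1 - n) = 1 := by ring
  rw [hsimp] at hb
  simp only [one_pow, mul_one] at hb
  set ξj := classicalLocation (n : ℝ) with hξj
  set Lj := Real.log ξj with hLj
  have hLj0 : 0 < Lj := Real.log_pos (one_lt_classicalLocation hn1)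
  have hn0 : (0 : ℝ) < n := by linarith
  have hlow := eq45_asPrinted_gap_lower hn1
  have hup : classicalLocation ((n : ℝ) + 1) - ξj - 4 * π / Lj ≤ A * (1 / (n * Lj ^ 2)) :=
    (le_abs_self _).trans hb
  have hcontra : π / Lj ^ 2 ≤ A * (1 / (n * Lj ^ 2)) := hlow.trans hup
  rw [div_le_iff₀ (by positivity)] at hcontra
  have : A * (1 / (n * Lj ^ 2)) * Lj ^ 2 = A / n := by field_simp
  rw [this, le_div_iff₀ hn0] at hcontra
  linarith

/-! ## Corollary 3.3 (50) as an RH-FREE schema: the printed deduction «(48) ⟹ (50)» at a fixed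
## time `t > Λ` («Repeating the previous analysis», FMP p.23, i.e. the Ψ-inversion of §3 p.20) -/

/-- Mean value lower bound for `Ψ` on `[4π, ∞)`: `(v − u)·log(u/4π)/(4π) ≤ Ψ(v) − Ψ(u)` for
`4π ≤ u ≤ v` (`Ψ' = log(·/4π)/(4π)` is increasing). [cite: RodgersTaoFMP2020, §3 eq. (39) p.20] -/
theorem rodgersTaoPsi_sub_ge {u v : ℝ} (hu : 4 * π ≤ u) (huv : u ≤ v) :
    (v - u) * (Real.log (u / (4 * π)) / (4 * π)) ≤ rodgersTaoPsi v - rodgersTaoPsi u := by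
  have hπ : 0 < 4 * π := by positivity
  rcases huv.eq_or_lt with h | hlt
  · rw [h]; simp
  have hu0 : 0 < u := hπ.trans_le hu
  obtain ⟨θ, hθ, hslope⟩ := exists_hasDerivAt_eq_slope rodgersTaoPsi
      (fun T ↦ Real.log (T / (4 * π)) / (4 * π)) hlt continuous_rodgersTaoPsi.continuousOn
      (fun T hT ↦ hasDerivAt_rodgersTaoPsi (hu0.trans hT.1).ne')
  have hθu : Real.log (u / (4 * π)) / (4 * π) ≤ Real.log (θ / (4 * π)) / (4 * π) := by
    have : Real.log (u / (4 * π)) ≤ Real.log (θ / (4 * π)) :=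
      Real.log_le_log (div_pos hu0 hπ) (by gcongr; exact hθ.1.le)
    exact div_le_div_of_nonneg_right this hπ.le
  rw [hslope, le_div_iff₀ (by linarith)] at hθu
  linarith

/-- `log y ≤ 4·y^{1/4}` (`y > 0`), in the form `log y ≤ 4 √(√y)`. [folklore] -/
private theorem log_le_four_mul_sqrt_sqrt {y : ℝ} (hy : 0 < y) :
    Real.log y ≤ 4 * Real.sqrt (Real.sqrt y) := by
  have h1 : Real.log y = 4 * Real.log (Real.sqrt (Real.sqrt y)) := by
    rw [Real.log_sqrt (Real.sqrt_nonneg _), Real.log_sqrt hy.le]; ring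
  have h2 : Real.log (Real.sqrt (Real.sqrt y)) ≤ Real.sqrt (Real.sqrt y) - 1 :=
    Real.log_le_sub_one_of_pos (Real.sqrt_pos.mpr (Real.sqrt_pos.mpr hy))
  linarith

/-- Growth of `log₊²`: `log₊² X ≤ 23 √X` for `X ≥ 2`. [folklore] -/
private theorem logPlus_sq_le_sqrt {X : ℝ} (hX : 2 ≤ X) : logPlus X ^ 2 ≤ 23 * Real.sqrt X := by
  have hX0 : 0 < X := by linarith
  have hs : logPlus X ≤ 4 * Real.sqrt (Real.sqrt (2 + X)) := by
    rw [logPlus_of_nonneg hX0.le]; exact log_le_four_mul_sqrt_sqrt (by linarith)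
  have hL0 : 0 ≤ logPlus X := (logPlus_pos X).le
  have h1 : logPlus X ^ 2 ≤ 16 * Real.sqrt (2 + X) := by
    calc logPlus X ^ 2 ≤ (4 * Real.sqrt (Real.sqrt (2 + X))) ^ 2 := pow_le_pow_left₀ hL0 hs 2
      _ = 16 * Real.sqrt (2 + X) := by rw [mul_pow, Real.sq_sqrt (Real.sqrt_nonneg _)]; norm_num
  have h2 : Real.sqrt (2 + X) ≤ Real.sqrt 2 * Real.sqrt X := by
    rw [← Real.sqrt_mul (by norm_num : (0 : ℝ) ≤ 2)]
    exact Real.sqrt_le_sqrt (by linarith)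
  have h3 : Real.sqrt 2 < 1.42 := by
    rw [Real.sqrt_lt' (by norm_num)]; norm_num
  nlinarith [Real.sqrt_nonneg X, Real.sqrt_nonneg 2]

/-- **Corollary 3.3, eq. (50), as an RH-FREE schema** (the printed deduction, FMP p.23 «Repeating
the previous analysis, we conclude …», i.e. the `Ψ`-inversion of §3 p.20 applied to (48)): at any
fixed time `t > Λ` (so that `N_t` and `x_j(t)` enumerate the real zeros: `N_t([0, x_j(t)]) = j`,
`RodgersTaoZeroSet.lean`), a Riemann–von Mangoldt estimate of the printed shape (48)
`|N_t([0,T]) − Ψ(T)| ≤ A log₊² T` (`T > 0`) implies the macroscopic location law (50)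
`x_j(t) = ξ_j + O(log₊ ξ_j)` for all `j ≥ 1`, with an explicit constant
(`B = max(32πA, (X₀ + ξ_{J₀})/log 2)`, `X₀ = (4π)⁴ + (96πA + 1)²`, `J₀ = X₀² + A(2 + X₀)²`).
Proof as printed: `Ψ(ξ_j) = j = N_t([0, x_j])`, so `|Ψ(ξ_j) − Ψ(x_j)| ≤ A log₊² x_j`, and the mean
value theorem for `Ψ` (`Ψ' = log(·/4π)/4π ≍ log₊` at both points, because `ξ_j ≥ x_j/2` for
`x_j ≥ X₀`) inverts this; small `x_j < X₀` forces `j ≤ J₀`. No hypothesis `t ≤ 0` and no use of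
the standing hypothesis: this is the content of Corollary 3.3 (50) separated from Theorem 3.2.
[cite: RodgersTaoFMP2020, Corollary 3.3 = Corollary 10 eq. (50) p.23 (deduction from (48))] -/
theorem cor33_location_of_count_estimate {t : ℝ}
    (hΛ : ∃ t₁ : ℝ, t₁ < t ∧ HasOnlyRealZeros (deBruijnH t₁)) {A : ℝ}
    (h48 : ∀ T : ℝ, 0 < T →
      |(deBruijnZeroCount t (Icc 0 T) : ℝ) - rodgersTaoPsi T| ≤ A * logPlus T ^ 2) :
    ∃ B : ℝ, ∀ j : ℕ, 1 ≤ j →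
      |deBruijnZero t j - classicalLocation (j : ℝ)| ≤ B * logPlus (classicalLocation (j : ℝ)) := by
  have hπ0 : 0 < π := Real.pi_pos
  have hπ : 0 < 4 * π := by positivity
  have hπ3 := Real.pi_gt_three
  have hA0 : 0 ≤ A := by
    have h := h48 1 one_pos
    by_contra hA
    have hA : A < 0 := lt_of_not_ge hA
    have : A * logPlus 1 ^ 2 < 0 := mul_neg_of_neg_of_pos hA (pow_pos (logPlus_pos 1) 2)
    linarith [abs_nonneg ((deBruijnZeroCount t (Icc 0 1) : ℝ) - rodgersTaoPsi 1)]
  -- thresholds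
  obtain ⟨X₀, hX₀⟩ : ∃ X₀ : ℝ, X₀ = (4 * π) ^ 4 + (96 * π * A + 1) ^ 2 := ⟨_, rfl⟩
  obtain ⟨J₀, hJ₀⟩ : ∃ J₀ : ℝ, J₀ = X₀ ^ 2 + A * (2 + X₀) ^ 2 := ⟨_, rfl⟩
  have h4π2 : (2 : ℝ) ≤ 4 * π := by linarith
  have hpow4 : 2 * (4 * π) ≤ (4 * π) ^ 4 := by
    have h3 : (2 : ℝ) ^ 3 ≤ (4 * π) ^ 3 := pow_le_pow_left₀ (by norm_num) h4π2 3
    calc 2 * (4 * π) ≤ 2 ^ 3 * (4 * π) := by linarith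
      _ ≤ (4 * π) ^ 3 * (4 * π) := mul_le_mul_of_nonneg_right h3 hπ.le
      _ = (4 * π) ^ 4 := by ring
  have hsqA : 0 ≤ (96 * π * A + 1) ^ 2 := sq_nonneg _
  have hX₀1 : (4 * π) ^ 4 ≤ X₀ := by rw [hX₀]; linarith
  have hX₀pos : 0 < X₀ := lt_of_lt_of_le (pow_pos hπ 4) hX₀1
  have hX₀one : 1 ≤ X₀ := by linarith
  have hJ₀1 : 1 ≤ J₀ := by
    have h1 : 1 ≤ X₀ ^ 2 := one_le_pow₀ hX₀one
    have h2 : 0 ≤ A * (2 + X₀) ^ 2 := mul_nonneg hA0 (sq_nonneg _)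
    rw [hJ₀]; linarith
  have hlog2 : 0 < Real.log 2 := Real.log_pos one_lt_two
  have hlog2' : Real.log 2 < 1 := by have := Real.log_two_lt_d9; linarith
  have hξJ₀ : 0 < classicalLocation J₀ := classicalLocation_pos (by linarith)
  set B : ℝ := max (32 * π * A) ((X₀ + classicalLocation J₀) / Real.log 2) with hB
  have hmaxB : 32 * π * A ≤ B := le_max_left _ _
  have hmaxB' : (X₀ + classicalLocation J₀) / Real.log 2 ≤ B := le_max_right _ _
  have hB0 : 0 ≤ B := le_trans (by positivity) hmaxB
  refine ⟨B, fun j hj ↦ ?_⟩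
  have hj1 : (1 : ℝ) ≤ j := by exact_mod_cast hj
  -- the two inputs about `x_j(t)`: it is positive and `N_t([0, x_j(t)]) = j`
  have hX0 : 0 < deBruijnZero t j := deBruijnZero_pos hΛ hj
  have h48X : |(j : ℝ) - rodgersTaoPsi (deBruijnZero t j)| ≤
      A * logPlus (deBruijnZero t j) ^ 2 := by
    have h := h48 _ hX0
    rwa [deBruijnZeroCount_Icc_deBruijnZero hΛ j] at h
  -- the inputs about `ξ_j`
  have hΨξ : rodgersTaoPsi (classicalLocation (j : ℝ)) = j :=
    rodgersTaoPsi_classicalLocation (by linarith)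
  have hξ4 : 4 * π ≤ classicalLocation (j : ℝ) := four_pi_le_classicalLocation (by linarith)
  have hξimp : (j : ℝ) ≤ J₀ → classicalLocation (j : ℝ) ≤ classicalLocation J₀ := fun h ↦
    (classicalLocation_le_iff (by linarith) (by linarith)).2 h
  generalize hXdef : deBruijnZero t j = X at hX0 h48X ⊢
  generalize hξdef : classicalLocation (j : ℝ) = ξ at hΨξ hξ4 hξimp ⊢
  clear hXdef hξdef h48 hΛ
  set L := logPlus X with hL
  have hξ0 : 0 < ξ := hπ.trans_le hξ4
  have hLξ2 : Real.log 2 ≤ logPlus ξ := log_two_le_logPlus ξ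
  have hLξ0 : 0 < logPlus ξ := logPlus_pos ξ
  have hL0 : 0 < L := logPlus_pos X
  have hdiff : |rodgersTaoPsi ξ - rodgersTaoPsi X| ≤ A * L ^ 2 := by rw [hΨξ]; exact h48X
  rcases lt_or_ge X X₀ with hsmall | hlarge
  · -- small zeros: j ≤ J₀, so everything is bounded
    have hjle : (j : ℝ) ≤ J₀ := by
      have h1 : (j : ℝ) ≤ rodgersTaoPsi X + A * L ^ 2 := by
        have := (abs_sub_le_iff.1 h48X).1; linarith
      have hΨle : rodgersTaoPsi X ≤ X₀ ^ 2 := by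
        rw [rodgersTaoPsi_eq_mul]
        have hy : 0 < X / (4 * π) := div_pos hX0 hπ
        have hlog : Real.log (X / (4 * π)) - 1 ≤ X / (4 * π) := by
          have := Real.log_le_sub_one_of_pos hy; linarith
        have hy1 : X / (4 * π) ≤ X := div_le_self hX0.le (by linarith)
        calc X / (4 * π) * (Real.log (X / (4 * π)) - 1) ≤ X / (4 * π) * (X / (4 * π)) :=
              mul_le_mul_of_nonneg_left hlog hy.le
          _ ≤ X * X := mul_le_mul hy1 hy1 hy.le hX0.le
          _ ≤ X₀ * X₀ := mul_le_mul hsmall.le hsmall.le hX0.le hX₀pos.le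
          _ = X₀ ^ 2 := by ring
      have hLle : L ≤ 2 + X₀ := by
        rw [hL, logPlus_of_nonneg hX0.le]
        have := Real.log_le_sub_one_of_pos (show 0 < 2 + X by linarith); linarith
      have hL2 : L ^ 2 ≤ (2 + X₀) ^ 2 := pow_le_pow_left₀ hL0.le hLle 2
      have hAL : A * L ^ 2 ≤ A * (2 + X₀) ^ 2 := mul_le_mul_of_nonneg_left hL2 hA0
      rw [hJ₀]; linarith
    have hξle : ξ ≤ classicalLocation J₀ := hξimp hjle
    have hbound : |X - ξ| ≤ X₀ + classicalLocation J₀ := by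
      rw [abs_le]; constructor <;> linarith
    have hq : 0 ≤ (X₀ + classicalLocation J₀) / Real.log 2 := by positivity
    calc |X - ξ| ≤ X₀ + classicalLocation J₀ := hbound
      _ = (X₀ + classicalLocation J₀) / Real.log 2 * Real.log 2 := by field_simp
      _ ≤ (X₀ + classicalLocation J₀) / Real.log 2 * logPlus ξ :=
          mul_le_mul_of_nonneg_left hLξ2 hq
      _ ≤ B * logPlus ξ := mul_le_mul_of_nonneg_right hmaxB' hLξ0.le
  · -- large zeros: Ψ-inversion by the mean value theorem
    have hX4 : (4 * π) ^ 4 ≤ X := hX₀1.trans hlarge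
    have hX8π : 2 * (4 * π) ≤ X := hpow4.trans hX4
    have hX2 : 2 ≤ X := by linarith
    have hX4π : 4 * π ≤ X := by linarith
    have hXhalf4π : 4 * π ≤ X / 2 := by linarith
    have hl4π := two_lt_log_four_pi
    have hl4π3 := log_four_pi_lt_three
    have hlogX : Real.log ((4 * π) ^ 4) ≤ Real.log X := Real.log_le_log (pow_pos hπ 4) hX4
    have hlogX8 : 8 < Real.log X := by rw [Real.log_pow] at hlogX; push_cast at hlogX; linarith
    have hlog8π : Real.log (8 * π) < 4 := by
      rw [show (8 : ℝ) * π = 2 * (4 * π) by ring, Real.log_mul (by norm_num) hπ.ne']; linarith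
    have h8π : 0 < 8 * π := by positivity
    have hlogX8π : Real.log (X / (8 * π)) = Real.log X - Real.log (8 * π) :=
      Real.log_div hX0.ne' h8π.ne'
    have hkey2 : 2 ≤ Real.log (X / (8 * π)) := by linarith
    have hLle : L ≤ 2 * Real.log X := by
      rw [hL, logPlus_of_nonneg hX0.le]
      have h1 : Real.log (2 + X) ≤ Real.log (2 * X) := Real.log_le_log (by linarith) (by linarith)
      rw [Real.log_mul (by norm_num) hX0.ne'] at h1
      linarith
    have hkeyL : L / 4 ≤ Real.log (X / (8 * π)) := by linarith
    have hX8π0 : 0 < X / (8 * π) := div_pos hX0 h8π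
    rcases le_or_gt ξ X with hξX | hXξ
    · -- ξ_j ≤ x_j: first ξ_j ≥ x_j / 2
      have hξhalf : X / 2 ≤ ξ := by
        by_contra hcon
        have hlt : ξ < X / 2 := lt_of_not_ge hcon
        have hmono := strictMonoOn_rodgersTaoPsi.monotoneOn (show ξ ∈ Ici (4 * π) from hξ4)
          (show X / 2 ∈ Ici (4 * π) from hXhalf4π) hlt.le
        have hmvt := rodgersTaoPsi_sub_ge hXhalf4π (show X / 2 ≤ X by linarith)
        rw [show X / 2 / (4 * π) = X / (8 * π) by ring, show X - X / 2 = X / 2 by ring] at hmvt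
        have hX20 : 0 ≤ X / 2 := by linarith
        have hlow : X / (4 * π) ≤ rodgersTaoPsi X - rodgersTaoPsi (X / 2) := by
          calc X / (4 * π) = X / 2 * (2 / (4 * π)) := by ring
            _ ≤ X / 2 * (Real.log (X / (8 * π)) / (4 * π)) :=
                mul_le_mul_of_nonneg_left (div_le_div_of_nonneg_right hkey2 hπ.le) hX20
            _ ≤ _ := hmvt
        have hup : rodgersTaoPsi X - rodgersTaoPsi (X / 2) ≤ A * L ^ 2 := by
          have := (abs_sub_le_iff.1 hdiff).2; linarith
        have hgrowth : L ^ 2 ≤ 23 * Real.sqrt X := logPlus_sq_le_sqrt hX2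
        have hsX0 : 0 < Real.sqrt X := Real.sqrt_pos.2 hX0
        have hss : Real.sqrt X * Real.sqrt X = X := Real.mul_self_sqrt hX0.le
        have hAg : A * L ^ 2 ≤ A * (23 * Real.sqrt X) := mul_le_mul_of_nonneg_left hgrowth hA0
        have h1 : X / (4 * π) ≤ 23 * A * Real.sqrt X := by linarith
        have h2 : Real.sqrt X ≤ 92 * π * A := by
          rw [div_le_iff₀ hπ] at h1
          have h1' : Real.sqrt X * Real.sqrt X ≤ 92 * π * A * Real.sqrt X := by
            rw [hss]; linarith
          exact le_of_mul_le_mul_right h1' hsX0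
        have h92 : 0 ≤ 92 * π * A := by positivity
        have h3 : X ≤ (92 * π * A) ^ 2 := by
          calc X = Real.sqrt X * Real.sqrt X := hss.symm
            _ ≤ (92 * π * A) * (92 * π * A) := mul_le_mul h2 h2 hsX0.le h92
            _ = (92 * π * A) ^ 2 := by ring
        have h4 : (92 * π * A) ^ 2 < X₀ := by
          have hπA : 0 ≤ π * A := mul_nonneg hπ0.le hA0
          have hfac : (96 * π * A + 1) ^ 2 - (92 * π * A) ^ 2 =
              (4 * π * A + 1) * (188 * π * A + 1) := by ring
          have hprod : 1 ≤ (4 * π * A + 1) * (188 * π * A + 1) :=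
            one_le_mul_of_one_le_of_one_le (by linarith) (by linarith)
          have := pow_pos hπ 4
          rw [hX₀]; linarith
        linarith
      have hmvt := rodgersTaoPsi_sub_ge hξ4 hξX
      have hlogξ : L / 4 ≤ Real.log (ξ / (4 * π)) := by
        have hle : X / (8 * π) ≤ ξ / (4 * π) := by
          rw [div_le_div_iff₀ h8π hπ]
          calc X * (4 * π) ≤ 2 * ξ * (4 * π) :=
                mul_le_mul_of_nonneg_right (by linarith) hπ.le
            _ = ξ * (8 * π) := by ring
        have : Real.log (X / (8 * π)) ≤ Real.log (ξ / (4 * π)) := Real.log_le_log hX8π0 hle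
        linarith
      have hup : rodgersTaoPsi X - rodgersTaoPsi ξ ≤ A * L ^ 2 := (abs_sub_le_iff.1 hdiff).2
      have hXξ0 : 0 ≤ X - ξ := by linarith
      have h1 : (X - ξ) * (L / 4 / (4 * π)) ≤ A * L ^ 2 := by
        calc (X - ξ) * (L / 4 / (4 * π)) ≤ (X - ξ) * (Real.log (ξ / (4 * π)) / (4 * π)) :=
              mul_le_mul_of_nonneg_left (div_le_div_of_nonneg_right hlogξ hπ.le) hXξ0
          _ ≤ A * L ^ 2 := hmvt.trans hup
      have h2 : X - ξ ≤ 16 * π * A * L := by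
        have h1' : (X - ξ) * L ≤ 16 * π * A * L * L := by
          have h16 : (0 : ℝ) ≤ 16 * π := by positivity
          have hm := mul_le_mul_of_nonneg_right h1 h16
          have e1 : (X - ξ) * (L / 4 / (4 * π)) * (16 * π) = (X - ξ) * L := by
            field_simp; ring
          have e2 : A * L ^ 2 * (16 * π) = 16 * π * A * L * L := by ring
          rwa [e1, e2] at hm
        exact le_of_mul_le_mul_right h1' hL0
      have hLξ : L ≤ 2 * logPlus ξ := by
        rw [hL, logPlus_of_nonneg hX0.le, logPlus_of_nonneg hξ0.le]
        have h1 : Real.log (2 + X) ≤ Real.log (2 * (2 + ξ)) :=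
          Real.log_le_log (by linarith) (by linarith)
        rw [Real.log_mul (by norm_num) (by linarith)] at h1
        have h2 : Real.log 4 ≤ Real.log (2 + X) := Real.log_le_log (by norm_num) (by linarith)
        have h4 : Real.log 4 = 2 * Real.log 2 := by
          rw [show (4 : ℝ) = 2 ^ 2 by norm_num, Real.log_pow]; ring
        linarith
      rw [abs_of_nonneg hXξ0]
      have hπA : 0 ≤ 16 * π * A := by positivity
      calc X - ξ ≤ 16 * π * A * L := h2
        _ ≤ 16 * π * A * (2 * logPlus ξ) := mul_le_mul_of_nonneg_left hLξ hπA
        _ = 32 * π * A * logPlus ξ := by ring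
        _ ≤ B * logPlus ξ := mul_le_mul_of_nonneg_right hmaxB hLξ0.le
    · -- x_j < ξ_j
      have hmvt := rodgersTaoPsi_sub_ge hX4π hXξ.le
      have hlogX' : L / 4 ≤ Real.log (X / (4 * π)) := by
        have hle : X / (8 * π) ≤ X / (4 * π) :=
          div_le_div_of_nonneg_left hX0.le hπ (by linarith)
        have : Real.log (X / (8 * π)) ≤ Real.log (X / (4 * π)) := Real.log_le_log hX8π0 hle
        linarith
      have hup : rodgersTaoPsi ξ - rodgersTaoPsi X ≤ A * L ^ 2 := (abs_sub_le_iff.1 hdiff).1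
      have hξX0 : 0 ≤ ξ - X := by linarith
      have h1 : (ξ - X) * (L / 4 / (4 * π)) ≤ A * L ^ 2 := by
        calc (ξ - X) * (L / 4 / (4 * π)) ≤ (ξ - X) * (Real.log (X / (4 * π)) / (4 * π)) :=
              mul_le_mul_of_nonneg_left (div_le_div_of_nonneg_right hlogX' hπ.le) hξX0
          _ ≤ A * L ^ 2 := hmvt.trans hup
      have h2 : ξ - X ≤ 16 * π * A * L := by
        have h1' : (ξ - X) * L ≤ 16 * π * A * L * L := by
          have h16 : (0 : ℝ) ≤ 16 * π := by positivity
          have hm := mul_le_mul_of_nonneg_right h1 h16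
          have e1 : (ξ - X) * (L / 4 / (4 * π)) * (16 * π) = (ξ - X) * L := by
            field_simp; ring
          have e2 : A * L ^ 2 * (16 * π) = 16 * π * A * L * L := by ring
          rwa [e1, e2] at hm
        exact le_of_mul_le_mul_right h1' hL0
      have hLξ : L ≤ logPlus ξ :=
        logPlus_le_logPlus (by rw [abs_of_pos hX0, abs_of_pos hξ0]; exact hXξ.le)
      rw [abs_sub_comm, abs_of_nonneg hξX0]
      have hπA : 0 ≤ 16 * π * A := by positivity
      have hAL : 0 ≤ 16 * π * A * logPlus ξ := mul_nonneg hπA hLξ0.le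
      calc ξ - X ≤ 16 * π * A * L := h2
        _ ≤ 16 * π * A * logPlus ξ := mul_le_mul_of_nonneg_left hLξ hπA
        _ ≤ 32 * π * A * logPlus ξ := by linarith
        _ ≤ B * logPlus ξ := mul_le_mul_of_nonneg_right hmaxB hLξ0.le

/-- `log₊² j ≤ 23 j` for real `j ≥ 1`. [folklore] -/
private theorem logPlus_sq_le_mul {j : ℝ} (hj : 1 ≤ j) : logPlus j ^ 2 ≤ 23 * j := by
  rcases le_or_gt 2 j with h2 | h2
  · have hs : Real.sqrt j ≤ j := by
      have h1 : 1 ≤ Real.sqrt j := Real.one_le_sqrt.mpr hj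
      have hss : Real.sqrt j * Real.sqrt j = j := Real.mul_self_sqrt (by linarith)
      nlinarith
    have := logPlus_sq_le_sqrt h2
    linarith
  · have hL : logPlus j ≤ Real.log 4 := by
      rw [logPlus_of_nonneg (by linarith)]
      exact Real.log_le_log (by linarith) (by linarith)
    have h4 : Real.log 4 < 2 := by
      have : Real.log 4 = 2 * Real.log 2 := by
        rw [show (4 : ℝ) = 2 ^ 2 by norm_num, Real.log_pow]; ring
      have := Real.log_two_lt_d9; linarith
    have hL0 : 0 ≤ logPlus j := (logPlus_pos j).le
    have : logPlus j ^ 2 ≤ 2 ^ 2 := pow_le_pow_left₀ hL0 (by linarith) 2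
    linarith

set_option maxHeartbeats 400000 in
/-- **Corollary 3.3, eq. (51), first comparison, as an RH-FREE schema**: at any fixed time
`t > Λ`, the location law (50) `|x_j(t) − ξ_j| ≤ B log₊ ξ_j` (`j ≥ 1`) implies
`x_j(t) ≍ j/log₊ ξ_j` for all `j ≥ 1` (constants depending on `B`, on the absolute constants of
Lemma 3.1 (i′) `lemma31_i_order_holds`, and — for the finitely many small `j` in the lower bound —
on `x_1(t) > 0`). The second comparison `j/log₊ ξ_j ≍ j/log₊ j` of (51) is `t`-free
(`lemma31_i_order_holds`). [cite: RodgersTaoFMP2020, Corollary 3.3 = Corollary 10 eq. (51) p.23] -/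
theorem cor33_order_of_location {t : ℝ}
    (hΛ : ∃ t₁ : ℝ, t₁ < t ∧ HasOnlyRealZeros (deBruijnH t₁)) {B : ℝ}
    (h50 : ∀ j : ℕ, 1 ≤ j →
      |deBruijnZero t j - classicalLocation (j : ℝ)| ≤ B * logPlus (classicalLocation (j : ℝ))) :
    ∃ c C : ℝ, 0 < c ∧ c ≤ C ∧ ∀ j : ℕ, 1 ≤ j →
      c * ((j : ℝ) / logPlus (classicalLocation (j : ℝ))) ≤ deBruijnZero t j ∧
        deBruijnZero t j ≤ C * ((j : ℝ) / logPlus (classicalLocation (j : ℝ))) := by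
  obtain ⟨c, C, hc, hcC, hord⟩ := lemma31_i_order_holds
  have hC : 0 < C := lt_of_lt_of_le hc hcC
  set B' : ℝ := max B 0 with hB'
  have hB'0 : 0 ≤ B' := le_max_right _ _
  have hBB' : B ≤ B' := le_max_left _ _
  have hx1 : 0 < deBruijnZero t 1 := deBruijnZero_pos hΛ le_rfl
  have hmonoAll : ∀ j : ℕ, 1 ≤ j → deBruijnZero t 1 ≤ deBruijnZero t j := fun j hj ↦
    (strictMono_deBruijnZero hΛ).monotone hj
  generalize hx₁ : deBruijnZero t 1 = x₁ at hx1 hmonoAll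
  clear hx₁
  have hlog2 : 0 < Real.log 2 := Real.log_pos one_lt_two
  obtain ⟨j₁, hj₁⟩ : ∃ j₁ : ℝ, j₁ = (46 * B' * C ^ 2 / c ^ 2) ^ 2 + 2 := ⟨_, rfl⟩
  have hj₁2 : 2 ≤ j₁ := by rw [hj₁]; nlinarith [sq_nonneg (46 * B' * C ^ 2 / c ^ 2)]
  have hj₁0 : 0 < j₁ := by linarith
  have hc2 : 0 < c ^ 2 / 2 := by positivity
  have hsmallc : 0 < x₁ * Real.log 2 / j₁ := by positivity
  refine ⟨min (c ^ 2 / 2) (x₁ * Real.log 2 / j₁), C ^ 2 + 23 * B' * C ^ 2,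
    lt_min hc2 hsmallc, ?_, fun j hj ↦ ?_⟩
  · have h1 : c ^ 2 / 2 ≤ C ^ 2 := by nlinarith [pow_le_pow_left₀ hc.le hcC 2]
    have h2 : 0 ≤ 23 * B' * C ^ 2 := by positivity
    exact (min_le_left _ _).trans (by linarith)
  have hj1 : (1 : ℝ) ≤ j := by exact_mod_cast hj
  have hj0 : (0 : ℝ) < j := by linarith
  obtain ⟨h1, h2, h3, h4⟩ := hord j hj1
  have hb := h50 j hj
  have hmono : x₁ ≤ deBruijnZero t j := hmonoAll j hj
  generalize hXdef : deBruijnZero t j = X at hb hmono ⊢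
  generalize hξdef : classicalLocation (j : ℝ) = ξ at h1 h2 h3 h4 hb ⊢
  clear hXdef hξdef h50 hmonoAll hord
  set Lj := logPlus (j : ℝ) with hLj
  set Lξ := logPlus ξ with hLξ
  have hLj0 : 0 < Lj := logPlus_pos _
  have hLξ0 : 0 < Lξ := logPlus_pos _
  have hLξ2 : Real.log 2 ≤ Lξ := log_two_le_logPlus ξ
  have hq0 : 0 < (j : ℝ) / Lξ := div_pos hj0 hLξ0
  -- `ξ_j ≍ j / log₊ ξ_j`
  have hξup : ξ ≤ C ^ 2 * ((j : ℝ) / Lξ) := by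
    have : C * ((j : ℝ) / Lj) ≤ C ^ 2 * ((j : ℝ) / Lξ) := by
      rw [show C ^ 2 * ((j : ℝ) / Lξ) = C * ((C * j) / Lξ) by ring]
      refine mul_le_mul_of_nonneg_left ?_ hC.le
      rw [div_le_div_iff₀ hLj0 hLξ0]
      nlinarith
    exact h2.trans this
  have hξlow : c ^ 2 * ((j : ℝ) / Lξ) ≤ ξ := by
    have : c ^ 2 * ((j : ℝ) / Lξ) ≤ c * ((j : ℝ) / Lj) := by
      rw [show c ^ 2 * ((j : ℝ) / Lξ) = c * ((c * j) / Lξ) by ring]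
      refine mul_le_mul_of_nonneg_left ?_ hc.le
      rw [div_le_div_iff₀ hLξ0 hLj0]
      nlinarith
    exact this.trans h1
  -- `log₊² ξ_j ≤ 23 C² j`
  have hLξsq : Lξ ^ 2 ≤ 23 * C ^ 2 * j := by
    have hLj2 := logPlus_sq_le_mul hj1
    have : Lξ ^ 2 ≤ (C * Lj) ^ 2 := pow_le_pow_left₀ hLξ0.le h4 2
    nlinarith [sq_nonneg C]
  have hLξle : Lξ ≤ 23 * C ^ 2 * ((j : ℝ) / Lξ) := by
    rw [mul_div_assoc', le_div_iff₀ hLξ0]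
    calc Lξ * Lξ = Lξ ^ 2 := by ring
      _ ≤ 23 * C ^ 2 * j := hLξsq
  obtain ⟨hb1, hb2⟩ := abs_sub_le_iff.1 hb
  have hBL : B * Lξ ≤ B' * Lξ := mul_le_mul_of_nonneg_right hBB' hLξ0.le
  constructor
  · -- lower bound
    rcases le_or_gt j₁ (j : ℝ) with hjbig | hjsmall
    · have hj2 : (2 : ℝ) ≤ j := hj₁2.trans hjbig
      have hsqrt : 46 * B' * C ^ 2 / c ^ 2 ≤ Real.sqrt j := by
        have hnn : 0 ≤ 46 * B' * C ^ 2 / c ^ 2 := by positivity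
        have : (46 * B' * C ^ 2 / c ^ 2) ^ 2 ≤ j := by rw [hj₁] at hjbig; linarith
        calc 46 * B' * C ^ 2 / c ^ 2 = Real.sqrt ((46 * B' * C ^ 2 / c ^ 2) ^ 2) := by
              rw [Real.sqrt_sq hnn]
          _ ≤ Real.sqrt j := Real.sqrt_le_sqrt this
      have hsj : 0 < Real.sqrt j := Real.sqrt_pos.2 hj0
      have hss : Real.sqrt j * Real.sqrt j = j := Real.mul_self_sqrt hj0.le
      -- B' Lξ² ≤ (c²/2) j
      have hLξsq' : Lξ ^ 2 ≤ C ^ 2 * (23 * Real.sqrt j) := by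
        have := logPlus_sq_le_sqrt hj2
        have h' : Lξ ^ 2 ≤ (C * Lj) ^ 2 := pow_le_pow_left₀ hLξ0.le h4 2
        nlinarith [sq_nonneg C]
      have hkey : B' * Lξ ^ 2 ≤ c ^ 2 / 2 * j := by
        have e1 : 46 * B' * C ^ 2 ≤ c ^ 2 * Real.sqrt j := by
          have := mul_le_mul_of_nonneg_left hsqrt (le_of_lt (pow_pos hc 2))
          rwa [mul_div_cancel₀ _ (pow_pos hc 2).ne'] at this
        calc B' * Lξ ^ 2 ≤ B' * (C ^ 2 * (23 * Real.sqrt j)) :=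
              mul_le_mul_of_nonneg_left hLξsq' hB'0
          _ = (46 * B' * C ^ 2) * Real.sqrt j / 2 := by ring
          _ ≤ (c ^ 2 * Real.sqrt j) * Real.sqrt j / 2 := by gcongr
          _ = c ^ 2 / 2 * j := by rw [mul_assoc, hss]; ring
      have hBLξ : B' * Lξ ≤ c ^ 2 / 2 * ((j : ℝ) / Lξ) := by
        rw [mul_div_assoc', le_div_iff₀ hLξ0]
        calc B' * Lξ * Lξ = B' * Lξ ^ 2 := by ring
          _ ≤ c ^ 2 / 2 * j := hkey
      calc min (c ^ 2 / 2) (x₁ * Real.log 2 / j₁) * ((j : ℝ) / Lξ)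
          ≤ c ^ 2 / 2 * ((j : ℝ) / Lξ) := mul_le_mul_of_nonneg_right (min_le_left _ _) hq0.le
        _ = c ^ 2 * ((j : ℝ) / Lξ) - c ^ 2 / 2 * ((j : ℝ) / Lξ) := by ring
        _ ≤ ξ - B' * Lξ := by linarith
        _ ≤ X := by linarith
    · -- small j: x_j ≥ x_1
      have hjle : (j : ℝ) / Lξ ≤ j₁ / Real.log 2 := by
        rw [div_le_div_iff₀ hLξ0 hlog2]; nlinarith
      calc min (c ^ 2 / 2) (x₁ * Real.log 2 / j₁) * ((j : ℝ) / Lξ)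
          ≤ x₁ * Real.log 2 / j₁ * ((j : ℝ) / Lξ) :=
            mul_le_mul_of_nonneg_right (min_le_right _ _) hq0.le
        _ ≤ x₁ * Real.log 2 / j₁ * (j₁ / Real.log 2) :=
            mul_le_mul_of_nonneg_left hjle hsmallc.le
        _ = x₁ := by field_simp
        _ ≤ X := hmono
  · -- upper bound
    calc X ≤ ξ + B * Lξ := by linarith
      _ ≤ C ^ 2 * ((j : ℝ) / Lξ) + B' * (23 * C ^ 2 * ((j : ℝ) / Lξ)) := by
          have := mul_le_mul_of_nonneg_left hLξle hB'0
          linarith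
      _ = (C ^ 2 + 23 * B' * C ^ 2) * ((j : ℝ) / Lξ) := by ring

end Literature.NumberTheory.LFunctions.RodgersTao2020

end
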